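import Literature.AlgebraicGeometry.HodgeTheory.FermatHodgeClassesLiftToCurvePowersSumProofs
import Literature.AlgebraicGeometry.HodgeTheory.FermatHodgeClassesLiftToCurveAndJacobianPowersProofs
import Literature.AlgebraicGeometry.HodgeTheory.AlgebraicClassesPullback
import Literature.AlgebraicGeometry.HodgeTheory.AlgebraicClassesPullbackOfCupProduct
import Literature.AlgebraicGeometry.HodgeTheory.ComplexGysinSurjective
import Literature.AlgebraicGeometry.HodgeTheory.LefschetzOneOneHolds
import HarnessLib

/-!
# `FermatHodgeClassesLiftToCurvePowersSum` from ONE step of Shioda–Katsura's inductive structure: the induction on the dimension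

Topic `Literature/AlgebraicGeometry/HodgeTheory`. PROOF FILE (theorems only; no definition and no
named fact is introduced, D-0026), continuing `FermatHodgeClassesLiftToCurvePowersSumProofs`, whose
`FermatHodgeClassesLiftToCurvePowersSum_of_families` reduced the named fact
`FermatHodgeClassesLiftToCurvePowersSum` (Hodge classes of the Fermat variety `Xⁿₘ` lift along
correspondences from the powers `C_mᵏ` of the Fermat curve `C_m = X¹ₘ`) to the existence, for each
`m ≥ 1`, `p ≥ 1`, of a DOMINATING FAMILY: finitely many `ℂ`-linear maps
`Fᵢ : H^{2qᵢ}(C_m^{kᵢ}(ℂ); ℂ) → H²ᵖ(X²ᵖₘ(ℂ); ℂ)`, `qᵢ + eᵢ = p`, carrying algebraic classes to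
algebraic classes, rational classes to rational classes, Hodge type `(a, b)` to `(a + eᵢ, b + eᵢ)`,
whose images jointly contain the rational `(p, p)`-classes. T. Shioda, T. Katsura, *On Fermat
varieties*, Tôhoku Math. J. 31 (1979) (text read) obtain such a family "by induction on `r`"
(§3, p. 107–108: "the vector space `Hʳ(Xʳₘ)` can be naturally considered as a subspace of a direct
sum of spaces of the form `[H¹(X¹ₘ)^{⊗ …}]` with `r' ≤ r`, as is easily seen from Corollary 2.5 by
induction on `r`"; Remark 2.11) from ONE STEP, Cor. 2.5 (2.9) (= Prop. 2.4 (2.5) at `(r-1, 1)`,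
from the diagram (1.25) of Thm. 1.7 — blow-up of `X^{r-1}ₘ × X¹ₘ` along `X^{r-2}ₘ × X⁰ₘ`,
`μₘ`-quotient, blow-down onto `Xʳₘ` — with Lemma 2.1 (blow-up formula) and Lemma 2.2
(`H(X/G) = H(X)^G`)): `Hⁱ(Xʳₘ) ⊕ H^{i-2}(X^{r-2}ₘ)(-1) ⊕ ⊕ⱼ m H^{i-2j}(pt)(-j) ≅
[Hⁱ(X^{r-1}ₘ × X¹ₘ)]^{μₘ} ⊕ m H^{i-2}(X^{r-2}ₘ)(-1)`, the projection onto `Hⁱ(Xʳₘ)` being induced by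
the birational morphism (1.22) ((2.17)), and the same after multiplying the diagram by an auxiliary
non-singular projective factor ((2.18)–(2.19), `ψ × id`). THIS FILE DOES THE INDUCTION: it proves
the named fact from the one-step statement taken as a HYPOTHESIS (`hA`: the Fermat surface `X²ₘ`
from `X¹ₘ × X¹ₘ`, Remark 1.9, centre = points; `hB`: `X^{r+2}ₘ` from `X^{r+1}ₘ × X¹ₘ`, centre
components `Xʳₘ`, `r ≥ 1`), spelled on the tree's real carriers in even degrees `2c` with the
auxiliary factor `W`: every class of `H²ᶜ((X^{r+2}ₘ ⊗ W)(ℂ); ℂ)` is `Ψ x + Σₜ Θₜ yₜ` for `ℂ`-linear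
`Ψ` from `H²ᶜ(((X^{r+1}ₘ ⊗ X¹ₘ) ⊗ W)(ℂ); ℂ)` (in print `m⁻¹ (ψ × id)_* (β × id)^*`) and finitely many
`Θₜ` from `H^{2c-2}((Xʳₘ ⊗ W)(ℂ); ℂ)` (resp. `H^{2c-2}(W(ℂ); ℂ)` for `r = 0`; in print
`(ψ j × id)_* (π × id)^*` from the components of the centre), all carrying algebraic classes to
algebraic classes (codimension `+0`, resp. `+1`), rational classes to rational classes and Hodge
types `(a, b)` to `(a, b)`, resp. `(a + 1, b + 1)` (algebraic correspondences between non-singular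
projective varieties: Fulton Ch. 16, Cor. 19.2; Voisin I Thm. 7.31, §7.3.2). The hypothesis is NOT
vendored as a named fact here (D-0026; it is the geometric input the tree lacks — blow-ups of smooth
projective `ℂ`-schemes and the blow-up formula on `H*(–(ℂ); ℂ)`).

The induction (all "admissible family" statements are written out as `∃` over a finite index type,
hosts `C_mᵏ ⊗ W`):
* `exists_family_of_iso` — transport of the target along an isomorphism (pull-back along an
  isomorphism is onto, keeps algebraic classes, rational classes and Hodge types:
  `surjective_complexBetti_map_of_iso`, `mem_algebraicClasses_map_iff_of_iso`,
  `IsRationalClass.map`, `IsOfHodgeType.map_of_iso`);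
* `exists_family_of_tensor` — hosts `C_mᵏ ⊗ (C_m ⊗ W)` re-read as `C_m^{k+1} ⊗ W` along the
  associator (`SchemeOver.pow_succ`);
* `exists_family_curve`, `exists_family_unit` — the base cases `X¹ₘ ⊗ W = C_m¹ ⊗ W` (left unitor)
  and `W = C_m⁰ ⊗ W`;
* `exists_family_of_step` — one step: families for the two kinds of hosts of the step, composed
  with `Ψ` and the `Θₜ`, give a family for the target (index `ι_M ⊕ T × ι_P`);
* `exists_family_fermat_tensor` — **the induction on `r`** (two-step): for `m ≥ 1`, every `r`, every
  smooth projective `W` and every `c`, `H²ᶜ((X^{r+1}ₘ ⊗ W)(ℂ); ℂ)` carries an admissible dominating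
  family from the `C_mᵏ ⊗ W`;
* `exists_family_fermat` — `W = Spec ℂ` removed (right unitors): the dominating family for
  `H²ᶜ(Xⁿₘ(ℂ); ℂ)`, `n ≥ 1`, from the `C_mᵏ` — the hypothesis `hfam` of
  `FermatHodgeClassesLiftToCurvePowersSum_of_families` in every degree;
* `FermatHodgeClassesLiftToCurvePowersSum_of_inductiveStep` — **the named fact from the one-step
  statement** (`hA`, `hB`).
* `inductiveStepClause_of_spans` — the geometric shape of one clause of `hA`/`hB`: it follows from
  the spans of the diagram (1.25) `× W` (main span `M ← Z → V`, `dim Z = dim V`, with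
  `(ψ × id)_*(β × id)^*(alg) ⊆ alg`; finitely many exceptional spans `P ← Eₜ → V` with flat left leg)
  and the surjectivity (2.9), the transport properties being the tree's
  `isRationalHodgeMap_complexGysin_comp_map` and `complexGysin_map_mem_algebraicClasses_of_flat`.
* `complexGysin_map_mem_algebraicClasses_of_pullbackAlgebraic`, `blowupDiagram_joint_surjective`,
  `inductiveStepClause_of_blowupDiagram` — the residual made explicit: granted the tree's named fact
  `fulton1998_map_mem_algebraicClasses` (Fulton Cor. 19.2 (b), pull-back of algebraic classes along
  the non-flat blow-up), one clause of `hA`/`hB` follows from the varieties and morphisms of the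
  diagram (1.25) `× W` (blow-up `Z`, `b`, `f`; exceptional divisors `Eₜ` with flat `πₜ` and
  `jₜ : Eₜ ⟶ Z`) and its two printed cohomological inputs — the blow-up formula on `Z` (Lemma 2.1,
  spanning half) and the surjectivity of `f_* = (ψ × id)_*` ((2.3)–(2.9), (2.17)).

## References

* [ShiodaKatsura1979] T. Shioda, T. Katsura, On Fermat varieties, Tôhoku Math. J. 31 (1979)
  97–115: §1 Thm. 1.7 (1.25), Remarks 1.8–1.9, Cor. 1.11; §2 Lemma 2.1–2.3, Prop. 2.4 (2.5),
  Cor. 2.5 (2.9), (2.17)–(2.21), Thm. 2.10 (induction on `r`), Remark 2.11; §3 p. 107–108.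
* [VoisinHodgeI2002] C. Voisin, Hodge Theory and Complex Algebraic Geometry I, Thm. 7.31, §7.3.2.
* [Fulton1998] W. Fulton, Intersection Theory, Ch. 16 Def. 16.1.2; §19.2 Cor. 19.2; §6.7.
* [Voisin2025] C. Voisin, Hodge and generalized Hodge conjectures, coniveau and algebraic cycles,
  J. Open Math. Probl. 1 (2025), Cor. 2.12.
-/

noncomputable section

open CategoryTheory AlgebraicGeometry MonoidalCategory
open Literature.AlgebraicTopology.SingularHomology
open Literature.AlgebraicGeometry.Motives

namespace Literature.AlgebraicGeometry.HodgeTheory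

section Induction

variable {m : ℕ}

/-! ### Transport of admissible dominating families -/

/-- **Transport of the target along an isomorphism.** If `H²ᶜ(V(ℂ); ℂ)` carries a finite family of
`ℂ`-linear maps from the `H^{2qᵢ}((C_m^{kᵢ} ⊗ W)(ℂ); ℂ)` carrying algebraic classes to algebraic
classes, rational classes to rational classes, Hodge type `(a, b)` to `(a + eᵢ, b + eᵢ)`
(`qᵢ + eᵢ = c`) and jointly onto, then so does `H²ᶜ(V'(ℂ); ℂ)` for `e : V' ≅ V` (compose with
`e^*`, which is onto and keeps the three kinds of classes: `surjective_complexBetti_map_of_iso`,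
`mem_algebraicClasses_map_iff_of_iso`, `IsRationalClass.map`, `IsOfHodgeType.map_of_iso`); the
dimension parameter may be renamed along `dV = dV'`. [cite: ShiodaKatsura1979, §2 (2.17)–(2.19)]
[cite: VoisinHodgeI2002, §7.3.2] -/
theorem exists_family_of_iso {W V V' : Motives.SchemeOver ℂ} {w dV dV' c : ℕ} (e : V' ≅ V)
    (hd : dV = dV')
    (h : ∃ (ι : Type) (_ : Fintype ι) (k q e : ι → ℕ) (_ : ∀ i, q i + e i = c)
      (F : ∀ i, complexBetti ((fermatHypersurface 1 m).pow (k i) ⊗ W) (2 * q i) →ₗ[ℂ] complexBetti (V) (2 * c)),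
      (∀ i, ∀ a ∈ algebraicClasses ((fermatHypersurface 1 m).pow (k i) ⊗ W) (q i), F i a ∈ algebraicClasses (V) c) ∧
      (∀ i a, IsRationalClass a → IsRationalClass (F i a)) ∧
      (∀ i ⦃a b : ℕ⦄ ⦃x : complexBetti ((fermatHypersurface 1 m).pow (k i) ⊗ W) (2 * q i)⦄, a + b = 2 * q i →
          IsOfHodgeType (k i + w) ((fermatHypersurface 1 m).pow (k i) ⊗ W) (2 * q i) a b x →
            IsOfHodgeType (dV) (V) (2 * c) (a + e i) (b + e i) (F i x)) ∧
      ∀ z : complexBetti (V) (2 * c), z ∈ ⨆ i, LinearMap.range (F i)) :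
    ∃ (ι : Type) (_ : Fintype ι) (k q e : ι → ℕ) (_ : ∀ i, q i + e i = c)
      (F : ∀ i, complexBetti ((fermatHypersurface 1 m).pow (k i) ⊗ W) (2 * q i) →ₗ[ℂ] complexBetti (V') (2 * c)),
      (∀ i, ∀ a ∈ algebraicClasses ((fermatHypersurface 1 m).pow (k i) ⊗ W) (q i), F i a ∈ algebraicClasses (V') c) ∧
      (∀ i a, IsRationalClass a → IsRationalClass (F i a)) ∧
      (∀ i ⦃a b : ℕ⦄ ⦃x : complexBetti ((fermatHypersurface 1 m).pow (k i) ⊗ W) (2 * q i)⦄, a + b = 2 * q i →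
          IsOfHodgeType (k i + w) ((fermatHypersurface 1 m).pow (k i) ⊗ W) (2 * q i) a b x →
            IsOfHodgeType (dV') (V') (2 * c) (a + e i) (b + e i) (F i x)) ∧
      ∀ z : complexBetti (V') (2 * c), z ∈ ⨆ i, LinearMap.range (F i) := by
  subst hd
  obtain ⟨ι, _, k, q, e', hqe, F, halg, hrat, htyp, hsurj⟩ := h
  refine ⟨ι, inferInstance, k, q, e', hqe, fun i ↦ (complexBetti.map e.hom (2 * c)).hom ∘ₗ F i,
    fun i a ha ↦ ?_, fun i a ha ↦ ?_, fun i a b x hab hx ↦ ?_, fun z ↦ ?_⟩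
  · exact (mem_algebraicClasses_map_iff_of_iso e).2 (halg i a ha)
  · exact (hrat i a ha).map _
  · exact (htyp i hab hx).map_of_iso e
  · obtain ⟨y, rfl⟩ := surjective_complexBetti_map_of_iso e (2 * c) z
    have hy := hsurj y
    induction hy using Submodule.iSup_induction' with
    | mem i y hy =>
      obtain ⟨x, rfl⟩ := hy
      exact Submodule.mem_iSup_of_mem i ⟨x, rfl⟩
    | zero => rw [map_zero]; exact Submodule.zero_mem _
    | add y y' _ _ hy hy' => rw [map_add]; exact Submodule.add_mem _ hy hy'

/-- **Hosts `C_mᵏ ⊗ (C_m ⊗ W)` are hosts `C_m^{k+1} ⊗ W`** (`C_m^{k+1} = C_mᵏ ⊗ C_m`,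
`SchemeOver.pow_succ`, and the associator `(C_mᵏ ⊗ C_m) ⊗ W ≅ C_mᵏ ⊗ (C_m ⊗ W)`, an isomorphism,
along which pull-back is onto and keeps the three kinds of classes): an admissible dominating family
for `V` with auxiliary factor `C_m ⊗ W` is one with auxiliary factor `W`.
[cite: ShiodaKatsura1979, §2 (2.18)–(2.21)] -/
theorem exists_family_of_tensor {W V : Motives.SchemeOver ℂ} {w dV c : ℕ}
    (h : ∃ (ι : Type) (_ : Fintype ι) (k q e : ι → ℕ) (_ : ∀ i, q i + e i = c)
      (F : ∀ i, complexBetti ((fermatHypersurface 1 m).pow (k i) ⊗ (fermatHypersurface 1 m ⊗ W)) (2 * q i) →ₗ[ℂ] complexBetti (V) (2 * c)),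
      (∀ i, ∀ a ∈ algebraicClasses ((fermatHypersurface 1 m).pow (k i) ⊗ (fermatHypersurface 1 m ⊗ W)) (q i), F i a ∈ algebraicClasses (V) c) ∧
      (∀ i a, IsRationalClass a → IsRationalClass (F i a)) ∧
      (∀ i ⦃a b : ℕ⦄ ⦃x : complexBetti ((fermatHypersurface 1 m).pow (k i) ⊗ (fermatHypersurface 1 m ⊗ W)) (2 * q i)⦄, a + b = 2 * q i →
          IsOfHodgeType (k i + (1 + w)) ((fermatHypersurface 1 m).pow (k i) ⊗ (fermatHypersurface 1 m ⊗ W)) (2 * q i) a b x →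
            IsOfHodgeType (dV) (V) (2 * c) (a + e i) (b + e i) (F i x)) ∧
      ∀ z : complexBetti (V) (2 * c), z ∈ ⨆ i, LinearMap.range (F i)) :
    ∃ (ι : Type) (_ : Fintype ι) (k q e : ι → ℕ) (_ : ∀ i, q i + e i = c)
      (F : ∀ i, complexBetti ((fermatHypersurface 1 m).pow (k i) ⊗ W) (2 * q i) →ₗ[ℂ] complexBetti (V) (2 * c)),
      (∀ i, ∀ a ∈ algebraicClasses ((fermatHypersurface 1 m).pow (k i) ⊗ W) (q i), F i a ∈ algebraicClasses (V) c) ∧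
      (∀ i a, IsRationalClass a → IsRationalClass (F i a)) ∧
      (∀ i ⦃a b : ℕ⦄ ⦃x : complexBetti ((fermatHypersurface 1 m).pow (k i) ⊗ W) (2 * q i)⦄, a + b = 2 * q i →
          IsOfHodgeType (k i + w) ((fermatHypersurface 1 m).pow (k i) ⊗ W) (2 * q i) a b x →
            IsOfHodgeType (dV) (V) (2 * c) (a + e i) (b + e i) (F i x)) ∧
      ∀ z : complexBetti (V) (2 * c), z ∈ ⨆ i, LinearMap.range (F i) := by
  obtain ⟨ι, _, k, q, e', hqe, F, halg, hrat, htyp, hsurj⟩ := h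
  -- the associators `a i : (C^k ⊗ C) ⊗ W ≅ C^k ⊗ (C ⊗ W)`; pull back along their inverses
  refine ⟨ι, inferInstance, fun i ↦ k i + 1, q, e', hqe,
    fun i ↦ F i ∘ₗ (complexBetti.map (α_ ((fermatHypersurface 1 m).pow (k i))
      (fermatHypersurface 1 m) W).inv (2 * q i)).hom,
    fun i a ha ↦ ?_, fun i a ha ↦ ?_, fun i a b x hab hx ↦ ?_, fun z ↦ ?_⟩
  · exact halg i _ ((mem_algebraicClasses_map_iff_of_iso (α_ _ _ _).symm).2 ha)
  · exact hrat i _ (ha.map _)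
  · refine htyp i hab ?_
    have hx' := hx.map_of_iso (α_ ((fermatHypersurface 1 m).pow (k i)) (fermatHypersurface 1 m) W).symm
    rw [show k i + 1 + w = k i + (1 + w) by omega] at hx'
    exact hx'
  · have hz := hsurj z
    induction hz using Submodule.iSup_induction' with
    | mem i y hy =>
      obtain ⟨x, rfl⟩ := hy
      obtain ⟨x', rfl⟩ := surjective_complexBetti_map_of_iso
        (α_ ((fermatHypersurface 1 m).pow (k i)) (fermatHypersurface 1 m) W).symm (2 * q i) x
      exact Submodule.mem_iSup_of_mem i ⟨x', rfl⟩
    | zero => exact Submodule.zero_mem _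
    | add y y' _ _ hy hy' => exact Submodule.add_mem _ hy hy'

/-! ### Base cases: the curve and the auxiliary factor themselves -/

/-- **`X¹ₘ ⊗ W` is dominated by the host `C_m¹ ⊗ W`** (`C_m¹ = Spec ℂ ⊗ C_m`, left unitor): the
single map `((λ_{C_m})⁻¹ ⊗ W)^*`. [cite: ShiodaKatsura1979, §2 Thm. 2.10 (first step of the induction, r = 1)] -/
theorem exists_family_curve (W : Motives.SchemeOver ℂ) (w c : ℕ) :
    ∃ (ι : Type) (_ : Fintype ι) (k q e : ι → ℕ) (_ : ∀ i, q i + e i = c)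
      (F : ∀ i, complexBetti ((fermatHypersurface 1 m).pow (k i) ⊗ W) (2 * q i) →ₗ[ℂ] complexBetti (fermatHypersurface 1 m ⊗ W) (2 * c)),
      (∀ i, ∀ a ∈ algebraicClasses ((fermatHypersurface 1 m).pow (k i) ⊗ W) (q i), F i a ∈ algebraicClasses (fermatHypersurface 1 m ⊗ W) c) ∧
      (∀ i a, IsRationalClass a → IsRationalClass (F i a)) ∧
      (∀ i ⦃a b : ℕ⦄ ⦃x : complexBetti ((fermatHypersurface 1 m).pow (k i) ⊗ W) (2 * q i)⦄, a + b = 2 * q i →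
          IsOfHodgeType (k i + w) ((fermatHypersurface 1 m).pow (k i) ⊗ W) (2 * q i) a b x →
            IsOfHodgeType (1 + w) (fermatHypersurface 1 m ⊗ W) (2 * c) (a + e i) (b + e i) (F i x)) ∧
      ∀ z : complexBetti (fermatHypersurface 1 m ⊗ W) (2 * c), z ∈ ⨆ i, LinearMap.range (F i) := by
  -- `e : C ⊗ W ≅ (𝟙 ⊗ C) ⊗ W = C^1 ⊗ W`
  let e : fermatHypersurface 1 m ⊗ W ≅ (fermatHypersurface 1 m).pow 1 ⊗ W :=
    whiskerRightIso (λ_ (fermatHypersurface 1 m)).symm W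
  refine ⟨Unit, inferInstance, fun _ ↦ 1, fun _ ↦ c, fun _ ↦ 0, fun _ ↦ rfl,
    fun _ ↦ (complexBetti.map e.hom (2 * c)).hom, fun _ a ha ↦ ?_, fun _ a ha ↦ ?_,
    fun _ a b x hab hx ↦ ?_, fun z ↦ ?_⟩
  · exact (mem_algebraicClasses_map_iff_of_iso e).2 ha
  · exact ha.map _
  · exact hx.map_of_iso e
  · obtain ⟨y, rfl⟩ := surjective_complexBetti_map_of_iso e (2 * c) z
    exact Submodule.mem_iSup_of_mem () ⟨y, rfl⟩

/-- **`W` is dominated by the host `C_m⁰ ⊗ W = Spec ℂ ⊗ W`** (left unitor).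
[cite: ShiodaKatsura1979, §1 Remark 1.9 (the centre of the first blow-up is a set of points)] -/
theorem exists_family_unit (W : Motives.SchemeOver ℂ) (w c : ℕ) :
    ∃ (ι : Type) (_ : Fintype ι) (k q e : ι → ℕ) (_ : ∀ i, q i + e i = c)
      (F : ∀ i, complexBetti ((fermatHypersurface 1 m).pow (k i) ⊗ W) (2 * q i) →ₗ[ℂ] complexBetti (W) (2 * c)),
      (∀ i, ∀ a ∈ algebraicClasses ((fermatHypersurface 1 m).pow (k i) ⊗ W) (q i), F i a ∈ algebraicClasses (W) c) ∧
      (∀ i a, IsRationalClass a → IsRationalClass (F i a)) ∧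
      (∀ i ⦃a b : ℕ⦄ ⦃x : complexBetti ((fermatHypersurface 1 m).pow (k i) ⊗ W) (2 * q i)⦄, a + b = 2 * q i →
          IsOfHodgeType (k i + w) ((fermatHypersurface 1 m).pow (k i) ⊗ W) (2 * q i) a b x →
            IsOfHodgeType (w) (W) (2 * c) (a + e i) (b + e i) (F i x)) ∧
      ∀ z : complexBetti (W) (2 * c), z ∈ ⨆ i, LinearMap.range (F i) := by
  let e : W ≅ (fermatHypersurface 1 m).pow 0 ⊗ W := (λ_ W).symm
  refine ⟨Unit, inferInstance, fun _ ↦ 0, fun _ ↦ c, fun _ ↦ 0, fun _ ↦ rfl,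
    fun _ ↦ (complexBetti.map e.hom (2 * c)).hom, fun _ a ha ↦ ?_, fun _ a ha ↦ ?_,
    fun _ a b x hab hx ↦ ?_, fun z ↦ ?_⟩
  · exact (mem_algebraicClasses_map_iff_of_iso e).2 ha
  · exact ha.map _
  · have hx' := hx.map_of_iso e
    rw [Nat.zero_add] at hx'
    exact hx'
  · obtain ⟨y, rfl⟩ := surjective_complexBetti_map_of_iso e (2 * c) z
    exact Submodule.mem_iSup_of_mem () ⟨y, rfl⟩

/-! ### One step of the induction -/

/-- **One step.** Let `V` (the target, in print `X^{r+2}ₘ × W`), `M` (in print the blown-up product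
`X^{r+1}ₘ × X¹ₘ × W`) and `P` (a component `Xʳₘ × W` of the centre) be given with `ℂ`-linear
`Ψ : H²ᶜ(M) → H²ᶜ(V)` and finitely many `Θₜ : H^{2c₀}(P) → H²ᶜ(V)`, `c₀ + 1 = c`, carrying algebraic
classes to algebraic classes (codimension `+0`, resp. `+1`), rational classes to rational classes and
Hodge types `(a, b)` to `(a, b)`, resp. `(a + 1, b + 1)`, with `H²ᶜ(V) = im Ψ + Σₜ im Θₜ` (Cor. 2.5
(2.9) through (2.17)). If `H²ᶜ(M)` and the `H^{2c₀}(P)` carry admissible dominating families from hosts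
`C_mᵏ ⊗ W`, so does `H²ᶜ(V)`: the composites `Ψ ∘ Fᵢ` and `Θₜ ∘ Gⱼ` (index `ι_M ⊕ T × ι_P`; shifts
`eᵢ`, resp. `eⱼ + 1`). [cite: ShiodaKatsura1979, §2 Cor. 2.5 (2.9), (2.17) and Thm. 2.10 (proof)] -/
theorem exists_family_of_step {W V M P : Motives.SchemeOver ℂ} {w dV dM dP c : ℕ}
    (Ψ : complexBetti M (2 * c) →ₗ[ℂ] complexBetti V (2 * c)) {T : Type} [Fintype T]
    (Θ : ∀ c₀ : ℕ, c₀ + 1 = c → T → (complexBetti P (2 * c₀) →ₗ[ℂ] complexBetti V (2 * c)))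
    (hΨalg : ∀ x ∈ algebraicClasses M c, Ψ x ∈ algebraicClasses V c)
    (hΨrat : ∀ x, IsRationalClass x → IsRationalClass (Ψ x))
    (hΨtyp : ∀ ⦃a b : ℕ⦄ ⦃x⦄, a + b = 2 * c → IsOfHodgeType dM M (2 * c) a b x →
      IsOfHodgeType dV V (2 * c) a b (Ψ x))
    (hΘ : ∀ c₀ (h : c₀ + 1 = c) (t : T),
      (∀ y ∈ algebraicClasses P c₀, Θ c₀ h t y ∈ algebraicClasses V c) ∧
      (∀ y, IsRationalClass y → IsRationalClass (Θ c₀ h t y)) ∧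
      (∀ ⦃a b : ℕ⦄ ⦃y⦄, a + b = 2 * c₀ → IsOfHodgeType dP P (2 * c₀) a b y →
          IsOfHodgeType dV V (2 * c) (a + 1) (b + 1) (Θ c₀ h t y)))
    (hsurj : ∀ z : complexBetti V (2 * c),
      z ∈ LinearMap.range Ψ ⊔ ⨆ (c₀ : ℕ) (h : c₀ + 1 = c) (t : T), LinearMap.range (Θ c₀ h t))
    (hM : ∃ (ι : Type) (_ : Fintype ι) (k q e : ι → ℕ) (_ : ∀ i, q i + e i = c)
      (F : ∀ i, complexBetti ((fermatHypersurface 1 m).pow (k i) ⊗ W) (2 * q i) →ₗ[ℂ] complexBetti (M) (2 * c)),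
      (∀ i, ∀ a ∈ algebraicClasses ((fermatHypersurface 1 m).pow (k i) ⊗ W) (q i), F i a ∈ algebraicClasses (M) c) ∧
      (∀ i a, IsRationalClass a → IsRationalClass (F i a)) ∧
      (∀ i ⦃a b : ℕ⦄ ⦃x : complexBetti ((fermatHypersurface 1 m).pow (k i) ⊗ W) (2 * q i)⦄, a + b = 2 * q i →
          IsOfHodgeType (k i + w) ((fermatHypersurface 1 m).pow (k i) ⊗ W) (2 * q i) a b x →
            IsOfHodgeType (dM) (M) (2 * c) (a + e i) (b + e i) (F i x)) ∧
      ∀ z : complexBetti (M) (2 * c), z ∈ ⨆ i, LinearMap.range (F i))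
    (hP : ∀ c₀, c₀ + 1 = c → ∃ (ι : Type) (_ : Fintype ι) (k q e : ι → ℕ) (_ : ∀ i, q i + e i = c₀)
      (F : ∀ i, complexBetti ((fermatHypersurface 1 m).pow (k i) ⊗ W) (2 * q i) →ₗ[ℂ] complexBetti (P) (2 * c₀)),
      (∀ i, ∀ a ∈ algebraicClasses ((fermatHypersurface 1 m).pow (k i) ⊗ W) (q i), F i a ∈ algebraicClasses (P) c₀) ∧
      (∀ i a, IsRationalClass a → IsRationalClass (F i a)) ∧
      (∀ i ⦃a b : ℕ⦄ ⦃x : complexBetti ((fermatHypersurface 1 m).pow (k i) ⊗ W) (2 * q i)⦄, a + b = 2 * q i →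
          IsOfHodgeType (k i + w) ((fermatHypersurface 1 m).pow (k i) ⊗ W) (2 * q i) a b x →
            IsOfHodgeType (dP) (P) (2 * c₀) (a + e i) (b + e i) (F i x)) ∧
      ∀ z : complexBetti (P) (2 * c₀), z ∈ ⨆ i, LinearMap.range (F i)) :
    ∃ (ι : Type) (_ : Fintype ι) (k q e : ι → ℕ) (_ : ∀ i, q i + e i = c)
      (F : ∀ i, complexBetti ((fermatHypersurface 1 m).pow (k i) ⊗ W) (2 * q i) →ₗ[ℂ] complexBetti (V) (2 * c)),
      (∀ i, ∀ a ∈ algebraicClasses ((fermatHypersurface 1 m).pow (k i) ⊗ W) (q i), F i a ∈ algebraicClasses (V) c) ∧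
      (∀ i a, IsRationalClass a → IsRationalClass (F i a)) ∧
      (∀ i ⦃a b : ℕ⦄ ⦃x : complexBetti ((fermatHypersurface 1 m).pow (k i) ⊗ W) (2 * q i)⦄, a + b = 2 * q i →
          IsOfHodgeType (k i + w) ((fermatHypersurface 1 m).pow (k i) ⊗ W) (2 * q i) a b x →
            IsOfHodgeType (dV) (V) (2 * c) (a + e i) (b + e i) (F i x)) ∧
      ∀ z : complexBetti (V) (2 * c), z ∈ ⨆ i, LinearMap.range (F i) := by
  classical
  obtain ⟨ιM, _, kM, qM, eM, hqeM, FM, halgM, hratM, htypM, hsurjM⟩ := hM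
  -- the part of `H²ᶜ(V)` reached through `Ψ`
  have hΨle : ∀ {ι' : Type} (F' : ι' → Submodule ℂ (complexBetti V (2 * c))),
      (∀ i, LinearMap.range (Ψ ∘ₗ FM i) ≤ ⨆ j, F' j) → LinearMap.range Ψ ≤ ⨆ j, F' j := by
    intro ι' F' hF'
    rintro _ ⟨x, rfl⟩
    have hx := hsurjM x
    induction hx using Submodule.iSup_induction' with
    | mem i y hy =>
      obtain ⟨x', rfl⟩ := hy
      exact hF' i ⟨x', rfl⟩
    | zero => rw [map_zero]; exact Submodule.zero_mem _
    | add y y' _ _ hy hy' => rw [map_add]; exact Submodule.add_mem _ hy hy'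
  cases c with
  | zero =>
    -- `c = 0`: no contribution from the centre
    refine ⟨ιM, inferInstance, kM, qM, eM, hqeM, fun i ↦ Ψ ∘ₗ FM i, fun i a ha ↦ ?_,
      fun i a ha ↦ ?_, fun i a b x hab hx ↦ ?_, fun z ↦ ?_⟩
    · exact hΨalg _ (halgM i a ha)
    · exact hΨrat _ (hratM i a ha)
    · exact hΨtyp (by have := hqeM i; omega) (htypM i hab hx)
    · have hz := hsurj z
      have hbot : (⨆ (c₀ : ℕ) (h : c₀ + 1 = 0) (t : T), LinearMap.range (Θ c₀ h t)) = ⊥ :=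
        le_bot_iff.1 (iSup_le fun c₀ ↦ iSup_le fun h ↦ absurd h (by omega))
      rw [hbot, sup_bot_eq] at hz
      exact hΨle (fun i ↦ LinearMap.range (Ψ ∘ₗ FM i))
        (fun i ↦ le_iSup (fun j ↦ LinearMap.range (Ψ ∘ₗ FM j)) i) hz
  | succ c₀ =>
    -- `c = c₀ + 1`
    obtain ⟨ιP, _, kP, qP, eP, hqeP, FP, halgP, hratP, htypP, hsurjP⟩ := hP c₀ rfl
    -- the composite family, indexed by `ι_M ⊕ T × ι_P`
    let k' : ιM ⊕ (T × ιP) → ℕ := Sum.elim kM (fun ti ↦ kP ti.2)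
    let q' : ιM ⊕ (T × ιP) → ℕ := Sum.elim qM (fun ti ↦ qP ti.2)
    let e' : ιM ⊕ (T × ιP) → ℕ := Sum.elim eM (fun ti ↦ eP ti.2 + 1)
    let F' : ∀ s : ιM ⊕ (T × ιP),
        complexBetti ((fermatHypersurface 1 m).pow (k' s) ⊗ W) (2 * q' s) →ₗ[ℂ]
          complexBetti V (2 * (c₀ + 1)) := fun s ↦
      match s with
      | Sum.inl i => Ψ ∘ₗ FM i
      | Sum.inr ti => Θ c₀ rfl ti.1 ∘ₗ FP ti.2
    refine ⟨ιM ⊕ (T × ιP), inferInstance, k', q', e', ?_, F', ?_, ?_, ?_, fun z ↦ ?_⟩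
    · rintro (i | ⟨t, i⟩)
      · exact hqeM i
      · change qP i + (eP i + 1) = c₀ + 1
        have := hqeP i
        omega
    · rintro (i | ⟨t, i⟩) a ha
      · exact hΨalg _ (halgM i a ha)
      · exact (hΘ c₀ rfl t).1 _ (halgP i a ha)
    · rintro (i | ⟨t, i⟩) a ha
      · exact hΨrat _ (hratM i a ha)
      · exact (hΘ c₀ rfl t).2.1 _ (hratP i a ha)
    · rintro (i | ⟨t, i⟩) a b x hab hx
      · change a + b = 2 * qM i at hab
        change IsOfHodgeType dV V (2 * (c₀ + 1)) (a + eM i) (b + eM i) (Ψ (FM i x))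
        exact hΨtyp (by have := hqeM i; omega) (htypM i hab hx)
      · change a + b = 2 * qP i at hab
        have h1 := htypP i hab hx
        have h2 := (hΘ c₀ rfl t).2.2 (by have := hqeP i; omega) h1
        change IsOfHodgeType dV V (2 * (c₀ + 1)) (a + (eP i + 1)) (b + (eP i + 1)) (Θ c₀ rfl t (FP i x))
        rw [show a + (eP i + 1) = a + eP i + 1 by omega, show b + (eP i + 1) = b + eP i + 1 by omega]
        exact h2
    · have hz := hsurj z
      obtain ⟨u, hu, v, hv, rfl⟩ := Submodule.mem_sup.1 hz
      refine Submodule.add_mem _ ?_ ?_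
      · exact hΨle (fun s ↦ LinearMap.range (F' s))
          (fun i ↦ le_iSup (fun s ↦ LinearMap.range (F' s)) (Sum.inl i)) hu
      · -- the part reached through the `Θₜ`
        have hle : (⨆ (c₁ : ℕ) (h : c₁ + 1 = c₀ + 1) (t : T), LinearMap.range (Θ c₁ h t)) ≤
            ⨆ s, LinearMap.range (F' s) := by
          refine iSup_le fun c₁ ↦ iSup_le fun h ↦ ?_
          obtain rfl : c₁ = c₀ := by omega
          refine iSup_le fun t ↦ ?_
          rintro _ ⟨y, rfl⟩
          have hy := hsurjP y
          induction hy using Submodule.iSup_induction' with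
          | mem i y hy =>
            obtain ⟨x', rfl⟩ := hy
            exact le_iSup (fun s ↦ LinearMap.range (F' s)) (Sum.inr (t, i)) ⟨x', rfl⟩
          | zero => rw [map_zero]; exact Submodule.zero_mem _
          | add y y' _ _ hy hy' => rw [map_add]; exact Submodule.add_mem _ hy hy'
        exact hle hv

/-! ### The induction on the dimension -/

/-- **Shioda–Katsura's induction on `r`** (Thm. 2.10, proof; §3 p. 107–108; Remark 2.11), from the
one-step statement taken as hypotheses `hA` (`X²ₘ` from `X¹ₘ × X¹ₘ`, centre = points, Remark 1.9)
and `hB` (`X^{r+2}ₘ` from `X^{r+1}ₘ × X¹ₘ`, centre components `Xʳₘ`, `r ≥ 1`), both with an auxiliary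
smooth projective factor `W` ((2.18)–(2.19)) and in even degrees: for `m ≥ 1`, every `r`, every
smooth projective `W` of dimension `w` and every `c`, the cohomology `H²ᶜ((X^{r+1}ₘ ⊗ W)(ℂ); ℂ)`
carries a finite family of `ℂ`-linear maps from the `H^{2qᵢ}((C_m^{kᵢ} ⊗ W)(ℂ); ℂ)`, `qᵢ + eᵢ = c`,
carrying algebraic classes to algebraic classes, rational classes to rational classes, Hodge type
`(a, b)` to `(a + eᵢ, b + eᵢ)`, and jointly onto. Two-step induction: `r = 0` is the curve itself
(`exists_family_curve`); `r = 1` is `hA` with the families of `(X¹ₘ ⊗ X¹ₘ) ⊗ W` (the curve case at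
the factor `X¹ₘ ⊗ W`, re-read through the associator, `exists_family_of_iso`,
`exists_family_of_tensor`) and of `W` (`exists_family_unit`); `r + 2` is `hB` with the induction
hypotheses at `r + 1` (factor `X¹ₘ ⊗ W`) and at `r` (factor `W`) — `exists_family_of_step`.
[cite: ShiodaKatsura1979, §2 Cor. 2.5 (2.9), Thm. 2.10 (proof), Remark 2.11; §3 p. 107–108] -/
theorem exists_family_fermat_tensor
    (hA : ∀ (m : ℕ), 1 ≤ m → ∀ (w : ℕ) (W : Motives.SchemeOver ℂ), IsSmoothProjective w W → ∀ (c : ℕ),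
    ∃ (Ψ : complexBetti ((fermatHypersurface 1 m ⊗ fermatHypersurface 1 m) ⊗ W) (2 * c) →ₗ[ℂ] complexBetti (fermatHypersurface 2 m ⊗ W) (2 * c))
      (T : Type) (_ : Fintype T)
      (Θ : ∀ c₀ : ℕ, c₀ + 1 = c → T → (complexBetti (W) (2 * c₀) →ₗ[ℂ]
        complexBetti (fermatHypersurface 2 m ⊗ W) (2 * c))),
      (∀ x ∈ algebraicClasses ((fermatHypersurface 1 m ⊗ fermatHypersurface 1 m) ⊗ W) c, Ψ x ∈ algebraicClasses (fermatHypersurface 2 m ⊗ W) c) ∧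
      (∀ x, IsRationalClass x → IsRationalClass (Ψ x)) ∧
      (∀ ⦃a b : ℕ⦄ ⦃x⦄, a + b = 2 * c → IsOfHodgeType (2 + w) ((fermatHypersurface 1 m ⊗ fermatHypersurface 1 m) ⊗ W) (2 * c) a b x →
          IsOfHodgeType (2 + w) (fermatHypersurface 2 m ⊗ W) (2 * c) a b (Ψ x)) ∧
      (∀ c₀ (h : c₀ + 1 = c) (t : T),
        (∀ y ∈ algebraicClasses (W) c₀, Θ c₀ h t y ∈ algebraicClasses (fermatHypersurface 2 m ⊗ W) c) ∧
        (∀ y, IsRationalClass y → IsRationalClass (Θ c₀ h t y)) ∧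
        (∀ ⦃a b : ℕ⦄ ⦃y⦄, a + b = 2 * c₀ → IsOfHodgeType (w) (W) (2 * c₀) a b y →
            IsOfHodgeType (2 + w) (fermatHypersurface 2 m ⊗ W) (2 * c) (a + 1) (b + 1) (Θ c₀ h t y))) ∧
      ∀ z : complexBetti (fermatHypersurface 2 m ⊗ W) (2 * c),
        z ∈ LinearMap.range Ψ ⊔ ⨆ (c₀ : ℕ) (h : c₀ + 1 = c) (t : T), LinearMap.range (Θ c₀ h t))
    (hB : ∀ (m r : ℕ), 1 ≤ m → 1 ≤ r → ∀ (w : ℕ) (W : Motives.SchemeOver ℂ), IsSmoothProjective w W →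
    ∀ (c : ℕ),
    ∃ (Ψ : complexBetti ((fermatHypersurface (r + 1) m ⊗ fermatHypersurface 1 m) ⊗ W) (2 * c) →ₗ[ℂ] complexBetti (fermatHypersurface (r + 2) m ⊗ W) (2 * c))
      (T : Type) (_ : Fintype T)
      (Θ : ∀ c₀ : ℕ, c₀ + 1 = c → T → (complexBetti (fermatHypersurface r m ⊗ W) (2 * c₀) →ₗ[ℂ]
        complexBetti (fermatHypersurface (r + 2) m ⊗ W) (2 * c))),
      (∀ x ∈ algebraicClasses ((fermatHypersurface (r + 1) m ⊗ fermatHypersurface 1 m) ⊗ W) c, Ψ x ∈ algebraicClasses (fermatHypersurface (r + 2) m ⊗ W) c) ∧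
      (∀ x, IsRationalClass x → IsRationalClass (Ψ x)) ∧
      (∀ ⦃a b : ℕ⦄ ⦃x⦄, a + b = 2 * c → IsOfHodgeType (r + 2 + w) ((fermatHypersurface (r + 1) m ⊗ fermatHypersurface 1 m) ⊗ W) (2 * c) a b x →
          IsOfHodgeType (r + 2 + w) (fermatHypersurface (r + 2) m ⊗ W) (2 * c) a b (Ψ x)) ∧
      (∀ c₀ (h : c₀ + 1 = c) (t : T),
        (∀ y ∈ algebraicClasses (fermatHypersurface r m ⊗ W) c₀, Θ c₀ h t y ∈ algebraicClasses (fermatHypersurface (r + 2) m ⊗ W) c) ∧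
        (∀ y, IsRationalClass y → IsRationalClass (Θ c₀ h t y)) ∧
        (∀ ⦃a b : ℕ⦄ ⦃y⦄, a + b = 2 * c₀ → IsOfHodgeType (r + w) (fermatHypersurface r m ⊗ W) (2 * c₀) a b y →
            IsOfHodgeType (r + 2 + w) (fermatHypersurface (r + 2) m ⊗ W) (2 * c) (a + 1) (b + 1) (Θ c₀ h t y))) ∧
      ∀ z : complexBetti (fermatHypersurface (r + 2) m ⊗ W) (2 * c),
        z ∈ LinearMap.range Ψ ⊔ ⨆ (c₀ : ℕ) (h : c₀ + 1 = c) (t : T), LinearMap.range (Θ c₀ h t))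
    (hm : 1 ≤ m) (r : ℕ) {w : ℕ} {W : Motives.SchemeOver ℂ} (hW : IsSmoothProjective w W) (c : ℕ) :
    ∃ (ι : Type) (_ : Fintype ι) (k q e : ι → ℕ) (_ : ∀ i, q i + e i = c)
      (F : ∀ i, complexBetti ((fermatHypersurface 1 m).pow (k i) ⊗ W) (2 * q i) →ₗ[ℂ] complexBetti (fermatHypersurface (r + 1) m ⊗ W) (2 * c)),
      (∀ i, ∀ a ∈ algebraicClasses ((fermatHypersurface 1 m).pow (k i) ⊗ W) (q i), F i a ∈ algebraicClasses (fermatHypersurface (r + 1) m ⊗ W) c) ∧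
      (∀ i a, IsRationalClass a → IsRationalClass (F i a)) ∧
      (∀ i ⦃a b : ℕ⦄ ⦃x : complexBetti ((fermatHypersurface 1 m).pow (k i) ⊗ W) (2 * q i)⦄, a + b = 2 * q i →
          IsOfHodgeType (k i + w) ((fermatHypersurface 1 m).pow (k i) ⊗ W) (2 * q i) a b x →
            IsOfHodgeType (r + 1 + w) (fermatHypersurface (r + 1) m ⊗ W) (2 * c) (a + e i) (b + e i) (F i x)) ∧
      ∀ z : complexBetti (fermatHypersurface (r + 1) m ⊗ W) (2 * c), z ∈ ⨆ i, LinearMap.range (F i) := by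
  have hC : IsSmoothProjective 1 (fermatHypersurface 1 m) := isSmoothProjective_fermatHypersurface le_rfl hm
  -- two-step induction on `r`, for all `W` and `c` at once
  suffices key : ∀ r : ℕ,
      (∀ {w : ℕ} {W : Motives.SchemeOver ℂ}, IsSmoothProjective w W → ∀ c : ℕ,
        ∃ (ι : Type) (_ : Fintype ι) (k q e : ι → ℕ) (_ : ∀ i, q i + e i = c)
          (F : ∀ i, complexBetti ((fermatHypersurface 1 m).pow (k i) ⊗ W) (2 * q i) →ₗ[ℂ] complexBetti (fermatHypersurface (r + 1) m ⊗ W) (2 * c)),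
          (∀ i, ∀ a ∈ algebraicClasses ((fermatHypersurface 1 m).pow (k i) ⊗ W) (q i), F i a ∈ algebraicClasses (fermatHypersurface (r + 1) m ⊗ W) c) ∧
          (∀ i a, IsRationalClass a → IsRationalClass (F i a)) ∧
          (∀ i ⦃a b : ℕ⦄ ⦃x : complexBetti ((fermatHypersurface 1 m).pow (k i) ⊗ W) (2 * q i)⦄, a + b = 2 * q i →
              IsOfHodgeType (k i + w) ((fermatHypersurface 1 m).pow (k i) ⊗ W) (2 * q i) a b x →
                IsOfHodgeType (r + 1 + w) (fermatHypersurface (r + 1) m ⊗ W) (2 * c) (a + e i) (b + e i) (F i x)) ∧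
          ∀ z : complexBetti (fermatHypersurface (r + 1) m ⊗ W) (2 * c), z ∈ ⨆ i, LinearMap.range (F i)) ∧
      (∀ {w : ℕ} {W : Motives.SchemeOver ℂ}, IsSmoothProjective w W → ∀ c : ℕ,
        ∃ (ι : Type) (_ : Fintype ι) (k q e : ι → ℕ) (_ : ∀ i, q i + e i = c)
          (F : ∀ i, complexBetti ((fermatHypersurface 1 m).pow (k i) ⊗ W) (2 * q i) →ₗ[ℂ] complexBetti (fermatHypersurface (r + 2) m ⊗ W) (2 * c)),
          (∀ i, ∀ a ∈ algebraicClasses ((fermatHypersurface 1 m).pow (k i) ⊗ W) (q i), F i a ∈ algebraicClasses (fermatHypersurface (r + 2) m ⊗ W) c) ∧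
          (∀ i a, IsRationalClass a → IsRationalClass (F i a)) ∧
          (∀ i ⦃a b : ℕ⦄ ⦃x : complexBetti ((fermatHypersurface 1 m).pow (k i) ⊗ W) (2 * q i)⦄, a + b = 2 * q i →
              IsOfHodgeType (k i + w) ((fermatHypersurface 1 m).pow (k i) ⊗ W) (2 * q i) a b x →
                IsOfHodgeType (r + 2 + w) (fermatHypersurface (r + 2) m ⊗ W) (2 * c) (a + e i) (b + e i) (F i x)) ∧
          ∀ z : complexBetti (fermatHypersurface (r + 2) m ⊗ W) (2 * c), z ∈ ⨆ i, LinearMap.range (F i)) from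
    (key r).1 hW c
  intro r
  induction r with
  | zero =>
    refine ⟨fun {w W} hW c ↦ ?_, fun {w W} hW c ↦ ?_⟩
    · -- `r = 0`: the curve
      have h := exists_family_curve (m := m) W w c
      rw [show 0 + 1 + w = 1 + w by omega]
      exact h
    · -- `r = 1`: the Fermat surface, `hA`
      obtain ⟨Ψ, T, _, Θ, hΨalg, hΨrat, hΨtyp, hΘ, hsurj⟩ := hA m hm w W hW c
      have hM : ∃ (ι : Type) (_ : Fintype ι) (k q e : ι → ℕ) (_ : ∀ i, q i + e i = c)
            (F : ∀ i, complexBetti ((fermatHypersurface 1 m).pow (k i) ⊗ W) (2 * q i) →ₗ[ℂ] complexBetti ((fermatHypersurface 1 m ⊗ fermatHypersurface 1 m) ⊗ W) (2 * c)),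
            (∀ i, ∀ a ∈ algebraicClasses ((fermatHypersurface 1 m).pow (k i) ⊗ W) (q i), F i a ∈ algebraicClasses ((fermatHypersurface 1 m ⊗ fermatHypersurface 1 m) ⊗ W) c) ∧
            (∀ i a, IsRationalClass a → IsRationalClass (F i a)) ∧
            (∀ i ⦃a b : ℕ⦄ ⦃x : complexBetti ((fermatHypersurface 1 m).pow (k i) ⊗ W) (2 * q i)⦄, a + b = 2 * q i →
                IsOfHodgeType (k i + w) ((fermatHypersurface 1 m).pow (k i) ⊗ W) (2 * q i) a b x →
                  IsOfHodgeType (2 + w) ((fermatHypersurface 1 m ⊗ fermatHypersurface 1 m) ⊗ W) (2 * c) (a + e i) (b + e i) (F i x)) ∧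
            ∀ z : complexBetti ((fermatHypersurface 1 m ⊗ fermatHypersurface 1 m) ⊗ W) (2 * c), z ∈ ⨆ i, LinearMap.range (F i) := by
        refine exists_family_of_tensor (exists_family_of_iso (α_ _ _ _) (by omega)
          (exists_family_curve (m := m) (fermatHypersurface 1 m ⊗ W) (1 + w) c))
      have h := exists_family_of_step Ψ Θ hΨalg hΨrat hΨtyp hΘ hsurj hM
        (fun c₀ _ ↦ exists_family_unit (m := m) W w c₀)
      rw [show 0 + 2 + w = 2 + w by omega]
      exact h
  | succ r ih =>
    refine ⟨ih.2, fun {w W} hW c ↦ ?_⟩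
    -- `r + 3`: `hB` at `r + 1 ≥ 1`
    obtain ⟨Ψ, T, _, Θ, hΨalg, hΨrat, hΨtyp, hΘ, hsurj⟩ := hB m (r + 1) hm (by omega) w W hW c
    have hCW : IsSmoothProjective (1 + w) (fermatHypersurface 1 m ⊗ W) := IsSmoothProjective.tensor_holds hC hW
    have hM : ∃ (ι : Type) (_ : Fintype ι) (k q e : ι → ℕ) (_ : ∀ i, q i + e i = c)
          (F : ∀ i, complexBetti ((fermatHypersurface 1 m).pow (k i) ⊗ W) (2 * q i) →ₗ[ℂ] complexBetti ((fermatHypersurface (r + 1 + 1) m ⊗ fermatHypersurface 1 m) ⊗ W) (2 * c)),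
          (∀ i, ∀ a ∈ algebraicClasses ((fermatHypersurface 1 m).pow (k i) ⊗ W) (q i), F i a ∈ algebraicClasses ((fermatHypersurface (r + 1 + 1) m ⊗ fermatHypersurface 1 m) ⊗ W) c) ∧
          (∀ i a, IsRationalClass a → IsRationalClass (F i a)) ∧
          (∀ i ⦃a b : ℕ⦄ ⦃x : complexBetti ((fermatHypersurface 1 m).pow (k i) ⊗ W) (2 * q i)⦄, a + b = 2 * q i →
              IsOfHodgeType (k i + w) ((fermatHypersurface 1 m).pow (k i) ⊗ W) (2 * q i) a b x →
                IsOfHodgeType (r + 1 + 2 + w) ((fermatHypersurface (r + 1 + 1) m ⊗ fermatHypersurface 1 m) ⊗ W) (2 * c) (a + e i) (b + e i) (F i x)) ∧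
          ∀ z : complexBetti ((fermatHypersurface (r + 1 + 1) m ⊗ fermatHypersurface 1 m) ⊗ W) (2 * c), z ∈ ⨆ i, LinearMap.range (F i) := by
      refine exists_family_of_tensor (exists_family_of_iso (α_ _ _ _) (by omega) (ih.2 hCW c))
    have h := exists_family_of_step Ψ Θ hΨalg hΨrat hΨtyp hΘ hsurj hM (fun c₀ _ ↦ ?_)
    · rw [show r + 1 + 2 + w = r + 1 + 2 + w from rfl]
      exact h
    · have h' := ih.1 hW c₀
      rw [show r + 1 + w = r + 1 + w from rfl]
      exact h'

/-! ### The auxiliary factor removed: dominating families for `H²ᶜ(Xⁿₘ(ℂ); ℂ)` from the `C_mᵏ` -/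

/-- **Every `H²ᶜ(Xⁿₘ(ℂ); ℂ)`, `n ≥ 1`, carries an admissible dominating family from the powers of the
Fermat curve**, granted the one-step statement: `exists_family_fermat_tensor` at `W = Spec ℂ`, the
right unitors `Xⁿₘ ⊗ Spec ℂ ≅ Xⁿₘ`, `C_mᵏ ⊗ Spec ℂ ≅ C_mᵏ` removing the auxiliary factor (pull-back
along an isomorphism is onto and keeps algebraic classes, rational classes and Hodge types). This is
"`Hʳ(Xʳₘ)` can be naturally considered as a subspace of a direct sum of spaces `H(X¹ₘ × ⋯ × X¹ₘ)`"
(§3, p. 107–108) in the covariant form, in all even degrees: the hypothesis `hfam` of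
`FermatHodgeClassesLiftToCurvePowersSum_of_families`. [cite: ShiodaKatsura1979, §2 Cor. 2.5 (2.9), Remark 2.11; §3 p. 107–108] -/
theorem exists_family_fermat
    (hA : ∀ (m : ℕ), 1 ≤ m → ∀ (w : ℕ) (W : Motives.SchemeOver ℂ), IsSmoothProjective w W → ∀ (c : ℕ),
    ∃ (Ψ : complexBetti ((fermatHypersurface 1 m ⊗ fermatHypersurface 1 m) ⊗ W) (2 * c) →ₗ[ℂ] complexBetti (fermatHypersurface 2 m ⊗ W) (2 * c))
      (T : Type) (_ : Fintype T)
      (Θ : ∀ c₀ : ℕ, c₀ + 1 = c → T → (complexBetti (W) (2 * c₀) →ₗ[ℂ]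
        complexBetti (fermatHypersurface 2 m ⊗ W) (2 * c))),
      (∀ x ∈ algebraicClasses ((fermatHypersurface 1 m ⊗ fermatHypersurface 1 m) ⊗ W) c, Ψ x ∈ algebraicClasses (fermatHypersurface 2 m ⊗ W) c) ∧
      (∀ x, IsRationalClass x → IsRationalClass (Ψ x)) ∧
      (∀ ⦃a b : ℕ⦄ ⦃x⦄, a + b = 2 * c → IsOfHodgeType (2 + w) ((fermatHypersurface 1 m ⊗ fermatHypersurface 1 m) ⊗ W) (2 * c) a b x →
          IsOfHodgeType (2 + w) (fermatHypersurface 2 m ⊗ W) (2 * c) a b (Ψ x)) ∧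
      (∀ c₀ (h : c₀ + 1 = c) (t : T),
        (∀ y ∈ algebraicClasses (W) c₀, Θ c₀ h t y ∈ algebraicClasses (fermatHypersurface 2 m ⊗ W) c) ∧
        (∀ y, IsRationalClass y → IsRationalClass (Θ c₀ h t y)) ∧
        (∀ ⦃a b : ℕ⦄ ⦃y⦄, a + b = 2 * c₀ → IsOfHodgeType (w) (W) (2 * c₀) a b y →
            IsOfHodgeType (2 + w) (fermatHypersurface 2 m ⊗ W) (2 * c) (a + 1) (b + 1) (Θ c₀ h t y))) ∧
      ∀ z : complexBetti (fermatHypersurface 2 m ⊗ W) (2 * c),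
        z ∈ LinearMap.range Ψ ⊔ ⨆ (c₀ : ℕ) (h : c₀ + 1 = c) (t : T), LinearMap.range (Θ c₀ h t))
    (hB : ∀ (m r : ℕ), 1 ≤ m → 1 ≤ r → ∀ (w : ℕ) (W : Motives.SchemeOver ℂ), IsSmoothProjective w W →
    ∀ (c : ℕ),
    ∃ (Ψ : complexBetti ((fermatHypersurface (r + 1) m ⊗ fermatHypersurface 1 m) ⊗ W) (2 * c) →ₗ[ℂ] complexBetti (fermatHypersurface (r + 2) m ⊗ W) (2 * c))
      (T : Type) (_ : Fintype T)
      (Θ : ∀ c₀ : ℕ, c₀ + 1 = c → T → (complexBetti (fermatHypersurface r m ⊗ W) (2 * c₀) →ₗ[ℂ]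
        complexBetti (fermatHypersurface (r + 2) m ⊗ W) (2 * c))),
      (∀ x ∈ algebraicClasses ((fermatHypersurface (r + 1) m ⊗ fermatHypersurface 1 m) ⊗ W) c, Ψ x ∈ algebraicClasses (fermatHypersurface (r + 2) m ⊗ W) c) ∧
      (∀ x, IsRationalClass x → IsRationalClass (Ψ x)) ∧
      (∀ ⦃a b : ℕ⦄ ⦃x⦄, a + b = 2 * c → IsOfHodgeType (r + 2 + w) ((fermatHypersurface (r + 1) m ⊗ fermatHypersurface 1 m) ⊗ W) (2 * c) a b x →
          IsOfHodgeType (r + 2 + w) (fermatHypersurface (r + 2) m ⊗ W) (2 * c) a b (Ψ x)) ∧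
      (∀ c₀ (h : c₀ + 1 = c) (t : T),
        (∀ y ∈ algebraicClasses (fermatHypersurface r m ⊗ W) c₀, Θ c₀ h t y ∈ algebraicClasses (fermatHypersurface (r + 2) m ⊗ W) c) ∧
        (∀ y, IsRationalClass y → IsRationalClass (Θ c₀ h t y)) ∧
        (∀ ⦃a b : ℕ⦄ ⦃y⦄, a + b = 2 * c₀ → IsOfHodgeType (r + w) (fermatHypersurface r m ⊗ W) (2 * c₀) a b y →
            IsOfHodgeType (r + 2 + w) (fermatHypersurface (r + 2) m ⊗ W) (2 * c) (a + 1) (b + 1) (Θ c₀ h t y))) ∧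
      ∀ z : complexBetti (fermatHypersurface (r + 2) m ⊗ W) (2 * c),
        z ∈ LinearMap.range Ψ ⊔ ⨆ (c₀ : ℕ) (h : c₀ + 1 = c) (t : T), LinearMap.range (Θ c₀ h t))
    (hm : 1 ≤ m) {n : ℕ} (hn : 1 ≤ n) (c : ℕ) :
    ∃ (ι : Type) (_ : Fintype ι) (k q e : ι → ℕ) (_ : ∀ i, q i + e i = c)
      (F : ∀ i, complexBetti ((fermatHypersurface 1 m).pow (k i)) (2 * q i) →ₗ[ℂ] complexBetti (fermatHypersurface n m) (2 * c)),
      (∀ i, ∀ a ∈ algebraicClasses ((fermatHypersurface 1 m).pow (k i)) (q i), F i a ∈ algebraicClasses (fermatHypersurface n m) c) ∧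
      (∀ i a, IsRationalClass a → IsRationalClass (F i a)) ∧
      (∀ i ⦃a b : ℕ⦄ ⦃x : complexBetti ((fermatHypersurface 1 m).pow (k i)) (2 * q i)⦄, a + b = 2 * q i →
          IsOfHodgeType (k i) ((fermatHypersurface 1 m).pow (k i)) (2 * q i) a b x →
            IsOfHodgeType n (fermatHypersurface n m) (2 * c) (a + e i) (b + e i) (F i x)) ∧
      ∀ z : complexBetti (fermatHypersurface n m) (2 * c), z ∈ ⨆ i, LinearMap.range (F i) := by
  obtain ⟨r, rfl⟩ : ∃ r, n = r + 1 := ⟨n - 1, by omega⟩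
  -- the family for `X^{r+1} ⊗ Spec ℂ`, transported to `X^{r+1}`
  obtain ⟨ι, _, k, q, e, hqe, F, halg, hrat, htyp, hsurj⟩ :=
    exists_family_of_iso (ρ_ (fermatHypersurface (r + 1) m)).symm (show r + 1 + 0 = r + 1 by omega)
      (exists_family_fermat_tensor hA hB hm r (isSmoothProjective_unit_holds ℂ) c)
  -- hosts `C^k ⊗ Spec ℂ ≅ C^k`
  refine ⟨ι, inferInstance, k, q, e, hqe,
    fun i ↦ F i ∘ₗ (complexBetti.map (ρ_ ((fermatHypersurface 1 m).pow (k i))).hom (2 * q i)).hom,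
    fun i a ha ↦ ?_, fun i a ha ↦ ?_, fun i a b x hab hx ↦ ?_, fun z ↦ ?_⟩
  · exact halg i _ ((mem_algebraicClasses_map_iff_of_iso (ρ_ _)).2 ha)
  · exact hrat i _ (ha.map _)
  · refine htyp i hab ?_
    rw [Nat.add_zero]
    exact hx.map_of_iso (ρ_ _)
  · have hz := hsurj z
    induction hz using Submodule.iSup_induction' with
    | mem i y hy =>
      obtain ⟨x, rfl⟩ := hy
      obtain ⟨x', rfl⟩ := surjective_complexBetti_map_of_iso
        (ρ_ ((fermatHypersurface 1 m).pow (k i))) (2 * q i) x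
      exact Submodule.mem_iSup_of_mem i ⟨x', rfl⟩
    | zero => exact Submodule.zero_mem _
    | add y y' _ _ hy hy' => exact Submodule.add_mem _ hy hy'

/-! ### The named fact from one step of the inductive structure -/

/-- **`FermatHodgeClassesLiftToCurvePowersSum` from ONE STEP of Shioda–Katsura's inductive
structure.** Granted, on the tree's real carriers, the surjectivity half of Cor. 2.5 (2.9) with an
auxiliary smooth projective factor `W` and in even degrees — `hA`: every class of
`H²ᶜ((X²ₘ ⊗ W)(ℂ); ℂ)` is `Ψ x + Σₜ Θₜ yₜ` for admissible `Ψ` from `H²ᶜ(((X¹ₘ ⊗ X¹ₘ) ⊗ W)(ℂ); ℂ)`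
(codimension and Hodge-type shift `0`) and finitely many admissible `Θₜ` from `H^{2c-2}(W(ℂ); ℂ)`
(shift `+1`) (the Fermat surface from the self-product of the Fermat curve blown up in `m²` points,
Remark 1.9 with Prop. 2.4 (2.5)); `hB`: the same for `X^{r+2}ₘ ⊗ W` from `(X^{r+1}ₘ ⊗ X¹ₘ) ⊗ W` and
the components `Xʳₘ ⊗ W` of the centre `Xʳₘ × X⁰ₘ × W`, `r ≥ 1` (Thm. 1.7 (1.25), Lemma 2.1–2.2,
Prop. 2.4, Cor. 2.5 (2.9), (2.17)–(2.19)); "admissible" meaning: carrying algebraic classes to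
algebraic classes, rational classes to rational classes and Hodge types `(a, b)` to `(a + e, b + e)`,
as the algebraic correspondences `m⁻¹(ψ × id)_*(β × id)^*`, `(ψ j × id)_*(π × id)^*` of the diagram
do (Fulton Ch. 16, Cor. 19.2; Voisin I Thm. 7.31, §7.3.2) — the named fact holds: the induction on
`r` (`exists_family_fermat`) supplies the dominating family `hfam` of
`FermatHodgeClassesLiftToCurvePowersSum_of_families` at `(m, 2p, p)`, and the Hodge classes lift
along it by Voisin 2025 Cor. 2.12 (proved: `curvePowersHodgeClassesLiftSum_of_family`). What the
tree still lacks for `FermatHodgeClassesLiftToCurvePowersSum_holds` is exactly `hA ∧ hB`: blow-ups of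
smooth projective `ℂ`-schemes with the blow-up formula, finite quotients with `H(X/G) = H(X)^G`, and
the degree-`m` morphism `ψ` of Thm. 1.7 on `H*(–(ℂ); ℂ)`.
[cite: ShiodaKatsura1979, §1 Thm. 1.7 (1.25), Remark 1.9, Cor. 1.11; §2 Lemma 2.1, Lemma 2.2, Prop. 2.4 (2.5), Cor. 2.5 (2.9), (2.17)–(2.19), Thm. 2.10, Remark 2.11; §3 p. 107–108]
[cite: Voisin2025, Prop. 2.11 and Cor. 2.12] [cite: VoisinHodgeI2002, Thm. 7.31 and §7.3.2]
[cite: Fulton1998, Ch. 16 Def. 16.1.2 and §19.2 Cor. 19.2] -/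
theorem FermatHodgeClassesLiftToCurvePowersSum_of_inductiveStep
    (hA : ∀ (m : ℕ), 1 ≤ m → ∀ (w : ℕ) (W : Motives.SchemeOver ℂ), IsSmoothProjective w W → ∀ (c : ℕ),
    ∃ (Ψ : complexBetti ((fermatHypersurface 1 m ⊗ fermatHypersurface 1 m) ⊗ W) (2 * c) →ₗ[ℂ] complexBetti (fermatHypersurface 2 m ⊗ W) (2 * c))
      (T : Type) (_ : Fintype T)
      (Θ : ∀ c₀ : ℕ, c₀ + 1 = c → T → (complexBetti (W) (2 * c₀) →ₗ[ℂ]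
        complexBetti (fermatHypersurface 2 m ⊗ W) (2 * c))),
      (∀ x ∈ algebraicClasses ((fermatHypersurface 1 m ⊗ fermatHypersurface 1 m) ⊗ W) c, Ψ x ∈ algebraicClasses (fermatHypersurface 2 m ⊗ W) c) ∧
      (∀ x, IsRationalClass x → IsRationalClass (Ψ x)) ∧
      (∀ ⦃a b : ℕ⦄ ⦃x⦄, a + b = 2 * c → IsOfHodgeType (2 + w) ((fermatHypersurface 1 m ⊗ fermatHypersurface 1 m) ⊗ W) (2 * c) a b x →
          IsOfHodgeType (2 + w) (fermatHypersurface 2 m ⊗ W) (2 * c) a b (Ψ x)) ∧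
      (∀ c₀ (h : c₀ + 1 = c) (t : T),
        (∀ y ∈ algebraicClasses (W) c₀, Θ c₀ h t y ∈ algebraicClasses (fermatHypersurface 2 m ⊗ W) c) ∧
        (∀ y, IsRationalClass y → IsRationalClass (Θ c₀ h t y)) ∧
        (∀ ⦃a b : ℕ⦄ ⦃y⦄, a + b = 2 * c₀ → IsOfHodgeType (w) (W) (2 * c₀) a b y →
            IsOfHodgeType (2 + w) (fermatHypersurface 2 m ⊗ W) (2 * c) (a + 1) (b + 1) (Θ c₀ h t y))) ∧
      ∀ z : complexBetti (fermatHypersurface 2 m ⊗ W) (2 * c),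
        z ∈ LinearMap.range Ψ ⊔ ⨆ (c₀ : ℕ) (h : c₀ + 1 = c) (t : T), LinearMap.range (Θ c₀ h t))
    (hB : ∀ (m r : ℕ), 1 ≤ m → 1 ≤ r → ∀ (w : ℕ) (W : Motives.SchemeOver ℂ), IsSmoothProjective w W →
    ∀ (c : ℕ),
    ∃ (Ψ : complexBetti ((fermatHypersurface (r + 1) m ⊗ fermatHypersurface 1 m) ⊗ W) (2 * c) →ₗ[ℂ] complexBetti (fermatHypersurface (r + 2) m ⊗ W) (2 * c))
      (T : Type) (_ : Fintype T)
      (Θ : ∀ c₀ : ℕ, c₀ + 1 = c → T → (complexBetti (fermatHypersurface r m ⊗ W) (2 * c₀) →ₗ[ℂ]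
        complexBetti (fermatHypersurface (r + 2) m ⊗ W) (2 * c))),
      (∀ x ∈ algebraicClasses ((fermatHypersurface (r + 1) m ⊗ fermatHypersurface 1 m) ⊗ W) c, Ψ x ∈ algebraicClasses (fermatHypersurface (r + 2) m ⊗ W) c) ∧
      (∀ x, IsRationalClass x → IsRationalClass (Ψ x)) ∧
      (∀ ⦃a b : ℕ⦄ ⦃x⦄, a + b = 2 * c → IsOfHodgeType (r + 2 + w) ((fermatHypersurface (r + 1) m ⊗ fermatHypersurface 1 m) ⊗ W) (2 * c) a b x →
          IsOfHodgeType (r + 2 + w) (fermatHypersurface (r + 2) m ⊗ W) (2 * c) a b (Ψ x)) ∧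
      (∀ c₀ (h : c₀ + 1 = c) (t : T),
        (∀ y ∈ algebraicClasses (fermatHypersurface r m ⊗ W) c₀, Θ c₀ h t y ∈ algebraicClasses (fermatHypersurface (r + 2) m ⊗ W) c) ∧
        (∀ y, IsRationalClass y → IsRationalClass (Θ c₀ h t y)) ∧
        (∀ ⦃a b : ℕ⦄ ⦃y⦄, a + b = 2 * c₀ → IsOfHodgeType (r + w) (fermatHypersurface r m ⊗ W) (2 * c₀) a b y →
            IsOfHodgeType (r + 2 + w) (fermatHypersurface (r + 2) m ⊗ W) (2 * c) (a + 1) (b + 1) (Θ c₀ h t y))) ∧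
      ∀ z : complexBetti (fermatHypersurface (r + 2) m ⊗ W) (2 * c),
        z ∈ LinearMap.range Ψ ⊔ ⨆ (c₀ : ℕ) (h : c₀ + 1 = c) (t : T), LinearMap.range (Θ c₀ h t)) :
    FermatHodgeClassesLiftToCurvePowersSum :=
  FermatHodgeClassesLiftToCurvePowersSum_of_families fun m p hm hp ↦ by
    obtain ⟨ι, _, k, q, e, hqe, F, halg, hrat, htyp, hsurj⟩ :=
      exists_family_fermat hA hB hm (n := 2 * p) (by omega) p
    exact ⟨ι, inferInstance, k, q, e, F, hqe, halg, hrat, htyp, fun c _ _ ↦ hsurj c⟩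

/-! ### The one-step statement from spans (the geometric shape of `hA`, `hB`) -/

/-- **One clause of the one-step statement from the SPANS of the diagram (1.25).** Let `V` be the
target (in print `X^{r+2}ₘ × W`, dimension `dV`), `M` the main host (`X^{r+1}ₘ × X¹ₘ × W`, same
dimension) and `P` a component of the centre (`Xʳₘ × W`, dimension `dP`, `dP + 2 = dV`). Suppose
given, for the half-degree `c`: a span `M ←b— Z —f→ V` of smooth projective varieties with
`dim Z = dV` (in print `b = β × id` the blow-up, NOT flat, and `f = ψ × id` of degree `m`) such that
`f_* ∘ b^*` carries `algebraicClasses M c` into `algebraicClasses V c` (`β^*` of an algebraic cycle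
class is algebraic, Fulton Ch. 6 / Cor. 19.2 — an input, since the tree has flat pull-back only); and
finitely many spans `P ←πₜ— Eₜ —gₜ→ V` with `dim Eₜ = dP + 1` and FLAT `πₜ` (in print the `ℙ¹`-bundles
`π : E → Y` over the components of the centre and `gₜ = (ψ ∘ j) × id`); and suppose
`H²ᶜ(V) = im (f_* b^*) + Σₜ im (gₜ_* πₜ^*)` from `H^{2c-2}(P)` (Cor. 2.5 (2.9) through (2.17)). Then
the clause holds at `(V, M, P, c)`: `Ψ = u • f_* b^*` and `Θₜ = uₜ • gₜ_* πₜ^*` (the orientation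
scalars making them defined over `ℚ`) carry algebraic classes to algebraic classes
(hypothesis, resp. `complexGysin_map_mem_algebraicClasses_of_flat`), rational classes to rational
classes and Hodge types `(a, b)` to `(a, b)`, resp. `(a + 1, b + 1)`
(`isRationalHodgeMap_complexGysin_comp_map`), with the same joint image. So what a geometric proof
of `hA`/`hB` has to supply is: the varieties and morphisms of the diagram (1.25) `× W` as smooth
projective `ℂ`-schemes, `(ψ × id)_*(β × id)^*(alg) ⊆ alg`, and the surjectivity (2.9).
[cite: ShiodaKatsura1979, §1 Thm. 1.7 (1.25); §2 Lemma 2.1, Prop. 2.4 (2.5), Cor. 2.5 (2.9), (2.17)–(2.19)]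
[cite: VoisinHodgeI2002, §7.3.2] [cite: Fulton1998, Ch. 16 Def. 16.1.2 and §19.2 Cor. 19.2] -/
theorem inductiveStepClause_of_spans (μ : OrientationFamily) {V M P Z : Motives.SchemeOver ℂ}
    {dV dP : ℕ} (hV : IsSmoothProjective dV V) (hM : IsSmoothProjective dV M)
    (hP : IsSmoothProjective dP P) (hdP : dP + 2 = dV) (c : ℕ)
    (hZ : IsSmoothProjective dV Z) (b : Z ⟶ M) (f : Z ⟶ V)
    (hbalg : ∀ x ∈ algebraicClasses M c,
      complexGysin μ hZ hV f (show 2 * c + 2 * dV = 2 * c + 2 * dV from rfl)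
        (complexBetti.map b (2 * c) x) ∈ algebraicClasses V c)
    {T : Type} [Fintype T] {E : T → Motives.SchemeOver ℂ}
    (hE : ∀ t, IsSmoothProjective (dP + 1) (E t)) (π : ∀ t, E t ⟶ P) [∀ t, Flat (π t).left]
    (g : ∀ t, E t ⟶ V)
    (hsurj : ∀ z : complexBetti V (2 * c),
      z ∈ LinearMap.range (complexGysin μ hZ hV f (show 2 * c + 2 * dV = 2 * c + 2 * dV from rfl) ∘ₗ
          (complexBetti.map b (2 * c)).hom) ⊔
        ⨆ (c₀ : ℕ) (h : c₀ + 1 = c) (t : T), LinearMap.range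
          (complexGysin μ (hE t) hV (g t) (show 2 * c₀ + 2 * dV = 2 * c + 2 * (dP + 1) by omega) ∘ₗ
            (complexBetti.map (π t) (2 * c₀)).hom)) :
    ∃ (Ψ : complexBetti M (2 * c) →ₗ[ℂ] complexBetti V (2 * c)) (T' : Type) (_ : Fintype T')
      (Θ : ∀ c₀ : ℕ, c₀ + 1 = c → T' → (complexBetti P (2 * c₀) →ₗ[ℂ] complexBetti V (2 * c))),
      (∀ x ∈ algebraicClasses M c, Ψ x ∈ algebraicClasses V c) ∧
      (∀ x, IsRationalClass x → IsRationalClass (Ψ x)) ∧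
      (∀ ⦃a b : ℕ⦄ ⦃x⦄, a + b = 2 * c → IsOfHodgeType dV M (2 * c) a b x →
          IsOfHodgeType dV V (2 * c) a b (Ψ x)) ∧
      (∀ c₀ (h : c₀ + 1 = c) (t : T'),
        (∀ y ∈ algebraicClasses P c₀, Θ c₀ h t y ∈ algebraicClasses V c) ∧
        (∀ y, IsRationalClass y → IsRationalClass (Θ c₀ h t y)) ∧
        (∀ ⦃a b : ℕ⦄ ⦃y⦄, a + b = 2 * c₀ → IsOfHodgeType dP P (2 * c₀) a b y →
            IsOfHodgeType dV V (2 * c) (a + 1) (b + 1) (Θ c₀ h t y))) ∧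
      ∀ z : complexBetti V (2 * c),
        z ∈ LinearMap.range Ψ ⊔ ⨆ (c₀ : ℕ) (h : c₀ + 1 = c) (t : T'), LinearMap.range (Θ c₀ h t) := by
  -- the main span: `u • f_* b^*` is a rational Hodge-linear map of bidegree `(0, 0)`
  obtain ⟨u, hu, hrat, htyp⟩ := isRationalHodgeMap_complexGysin_comp_map μ
    (OrientationFamily.hasPoincareDuality μ) hZ hM hV b f
    (show 2 * c + 2 * dV = 2 * c + 2 * dV from rfl) (Nat.add_zero c)
  -- the exceptional spans: `uₜ • gₜ_* πₜ^*`, bidegree `(1, 1)`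
  have key : ∀ (c₀ : ℕ) (h : c₀ + 1 = c) (t : T), ∃ u' : ℂ, u' ≠ 0 ∧
      (∀ y : complexBetti P (2 * c₀), IsRationalClass y →
        IsRationalClass (u' • complexGysin μ (hE t) hV (g t)
          (show 2 * c₀ + 2 * dV = 2 * c + 2 * (dP + 1) by omega) (complexBetti.map (π t) (2 * c₀) y))) ∧
      ∀ ⦃a b' : ℕ⦄ ⦃y : complexBetti P (2 * c₀)⦄, a + b' = 2 * c₀ → IsOfHodgeType dP P (2 * c₀) a b' y →
        IsOfHodgeType dV V (2 * c) (a + 1) (b' + 1)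
          (complexGysin μ (hE t) hV (g t) (show 2 * c₀ + 2 * dV = 2 * c + 2 * (dP + 1) by omega)
            (complexBetti.map (π t) (2 * c₀) y)) :=
    fun c₀ h t ↦ isRationalHodgeMap_complexGysin_comp_map μ (OrientationFamily.hasPoincareDuality μ)
      (hE t) hP hV (π t) (g t) _ h
  choose u' hu' hrat' htyp' using key
  refine ⟨u • (complexGysin μ hZ hV f (show 2 * c + 2 * dV = 2 * c + 2 * dV from rfl) ∘ₗ
      (complexBetti.map b (2 * c)).hom), T, inferInstance,
    fun c₀ h t ↦ u' c₀ h t • (complexGysin μ (hE t) hV (g t)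
      (show 2 * c₀ + 2 * dV = 2 * c + 2 * (dP + 1) by omega) ∘ₗ (complexBetti.map (π t) (2 * c₀)).hom),
    fun x hx ↦ ?_, fun x hx ↦ ?_, fun a b' x hab hx ↦ ?_, fun c₀ h t ↦ ⟨fun y hy ↦ ?_, fun y hy ↦ ?_,
      fun a b' y hab hy ↦ ?_⟩, fun z ↦ ?_⟩
  · rw [LinearMap.smul_apply]
    exact Submodule.smul_mem _ _ (hbalg x hx)
  · rw [LinearMap.smul_apply]
    exact hrat x hx
  · rw [LinearMap.smul_apply]
    exact (htyp hab hx).smul u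
  · -- flat pull-back then proper push-forward of algebraic classes
    rw [LinearMap.smul_apply]
    exact Submodule.smul_mem _ _ (complexGysin_map_mem_algebraicClasses_of_flat μ (hE t) hP hV
      (π t) (g t) (by omega) hy)
  · rw [LinearMap.smul_apply]
    exact hrat' c₀ h t y hy
  · rw [LinearMap.smul_apply]
    exact (htyp' c₀ h t hab hy).smul _
  · have e1 : LinearMap.range (u • (complexGysin μ hZ hV f
        (show 2 * c + 2 * dV = 2 * c + 2 * dV from rfl) ∘ₗ (complexBetti.map b (2 * c)).hom)) =
        LinearMap.range (complexGysin μ hZ hV f (show 2 * c + 2 * dV = 2 * c + 2 * dV from rfl) ∘ₗ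
          (complexBetti.map b (2 * c)).hom) := LinearMap.range_smul _ _ hu
    have e2 : ∀ (c₀ : ℕ) (h : c₀ + 1 = c) (t : T),
        LinearMap.range (u' c₀ h t • (complexGysin μ (hE t) hV (g t)
          (show 2 * c₀ + 2 * dV = 2 * c + 2 * (dP + 1) by omega) ∘ₗ
            (complexBetti.map (π t) (2 * c₀)).hom)) =
        LinearMap.range (complexGysin μ (hE t) hV (g t)
          (show 2 * c₀ + 2 * dV = 2 * c + 2 * (dP + 1) by omega) ∘ₗ
            (complexBetti.map (π t) (2 * c₀)).hom) :=
      fun c₀ h t ↦ LinearMap.range_smul _ _ (hu' c₀ h t)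
    rw [e1]
    simp_rw [e2]
    exact hsurj z

end Induction

/-! ### What remains of `hA`/`hB` after Fulton's Cor. 19.2 (b): the blow-up diagram and its two
cohomological inputs -/

section BlowupDiagram

/-- **The `alg → alg` clause of the main span from Fulton's Cor. 19.2 (b).** For a span
`M ←b— Z —f→ V` of smooth projective varieties, `f_* ∘ b^*` carries `algebraicClasses M k` into
`algebraicClasses V c`, `k + dim V = c + dim Z`, as soon as pull-backs along ARBITRARY morphisms of
smooth projective varieties preserve algebraic classes — the tree's named fact
`fulton1998_map_mem_algebraicClasses` (Fulton, Cor. 19.2 (b): "`cl` … contravariant for morphisms of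
non-singular varieties"), needed here because the blow-up `b = β × id` of the diagram (1.25) `× W`
is not flat (the flat case is the theorem `complexGysin_map_mem_algebraicClasses_of_flat`); the
push-forward half is the proved support form of the Gysin morphism
(`complexGysin_mem_algebraicClasses`, Fulton, *Young Tableaux* App. B §B.2). This is the hypothesis
`hbalg` of `inductiveStepClause_of_spans`.
[cite: Fulton1998, §19.2 Cor. 19.2 (b) and Ch. 16 Def. 16.1.2] [cite: ShiodaKatsura1979, §2 (2.17)–(2.19)] -/
theorem complexGysin_map_mem_algebraicClasses_of_pullbackAlgebraic (μ : OrientationFamily)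
    (hF : fulton1998_map_mem_algebraicClasses) {dZ dM dV : ℕ} {Z M V : Motives.SchemeOver ℂ}
    (hZ : IsSmoothProjective dZ Z) (hM : IsSmoothProjective dM M) (hV : IsSmoothProjective dV V)
    (b : Z ⟶ M) (f : Z ⟶ V) {k c : ℕ} (hc : k + dV = c + dZ) {x : complexBetti M (2 * k)}
    (hx : x ∈ algebraicClasses M k) :
    complexGysin μ hZ hV f (show 2 * k + 2 * dV = 2 * c + 2 * dZ by omega)
      (complexBetti.map b (2 * k) x) ∈ algebraicClasses V c :=
  complexGysin_mem_algebraicClasses (gysinMap_restrictCompl_eq_zero_of_field ℂ) μ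
    (OrientationFamily.hasPoincareDuality μ) hZ hV f hc _ (hF b hM hZ k x hx)

/-- **Surjectivity (2.9) from the blow-up formula and the surjectivity of `ψ_*`.** In the diagram
(1.25) `× W` — `M ←b— Z —f→ V` with `b = β × id` the blow-up of `M = X^{r+1}ₘ × X¹ₘ × W` along the
centre `⊔ₜ Pₜ`, `Pₜ ≅ Xʳₘ × W`, exceptional divisors `jₜ : Eₜ ⟶ Z` with their `ℙ¹`-bundle maps
`πₜ : Eₜ ⟶ P`, and `f = ψ × id` — the two printed cohomological inputs are: the blow-up formula
(Lemma 2.1 for a centre of codimension `2`: `Hⁱ(Z) = β^* Hⁱ(M) ⊕ ⊕ₜ jₜ,* πₜ^* H^{i-2}(Pₜ)`, of which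
only the spanning is used, hypothesis `hZspan`) and the surjectivity of `ψ_*` (`ψ_* ψ^* = m`, `ψ` of
degree `m`, (2.3)–(2.4); equivalently `Hⁱ(X^{r+s}ₘ)` is a direct summand of `Hⁱ(Z)^{μₘ}` through the
birational morphism (1.22), (2.6)–(2.8), (2.17); hypothesis `hf`). They give the joint surjectivity
`H²ᶜ(V) = f_* b^* H²ᶜ(M) + Σₜ (jₜ ≫ f)_* πₜ^* H^{2c-2}(P)` — the hypothesis `hsurj` of
`inductiveStepClause_of_spans` with `gₜ = jₜ ≫ f` — by the functoriality `f_* ∘ jₜ,* = (jₜ ≫ f)_*`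
of the Gysin morphisms (`complexGysin_comp`).
[cite: ShiodaKatsura1979, §2 Lemma 2.1, (2.3)–(2.9), (2.17)–(2.19)] [cite: VoisinHodgeI2002, Thm. 7.31 and §7.3.2] -/
theorem blowupDiagram_joint_surjective (μ : OrientationFamily) {V M P Z : Motives.SchemeOver ℂ}
    {dV dP : ℕ} (hV : IsSmoothProjective dV V) (hdP : dP + 2 = dV)
    (c : ℕ) (hZ : IsSmoothProjective dV Z) (b : Z ⟶ M) (f : Z ⟶ V)
    {T : Type} {E : T → Motives.SchemeOver ℂ} (hE : ∀ t, IsSmoothProjective (dP + 1) (E t))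
    (π : ∀ t, E t ⟶ P) (j : ∀ t, E t ⟶ Z)
    (hZspan : ∀ z : complexBetti Z (2 * c),
      z ∈ LinearMap.range (complexBetti.map b (2 * c)).hom ⊔
        ⨆ (c₀ : ℕ) (h : c₀ + 1 = c) (t : T), LinearMap.range
          (complexGysin μ (hE t) hZ (j t) (show 2 * c₀ + 2 * dV = 2 * c + 2 * (dP + 1) by omega) ∘ₗ
            (complexBetti.map (π t) (2 * c₀)).hom))
    (hf : Function.Surjective
      (complexGysin μ hZ hV f (show 2 * c + 2 * dV = 2 * c + 2 * dV from rfl))) :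
    ∀ z : complexBetti V (2 * c),
      z ∈ LinearMap.range (complexGysin μ hZ hV f (show 2 * c + 2 * dV = 2 * c + 2 * dV from rfl) ∘ₗ
          (complexBetti.map b (2 * c)).hom) ⊔
        ⨆ (c₀ : ℕ) (h : c₀ + 1 = c) (t : T), LinearMap.range
          (complexGysin μ (hE t) hV (j t ≫ f)
              (show 2 * c₀ + 2 * dV = 2 * c + 2 * (dP + 1) by omega) ∘ₗ
            (complexBetti.map (π t) (2 * c₀)).hom) := by
  intro z
  obtain ⟨z', rfl⟩ := hf z
  -- `(jₜ ≫ f)_* ∘ πₜ^* = f_* ∘ (jₜ,* ∘ πₜ^*)` (functoriality of the Gysin morphisms)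
  have hcomp : ∀ (c₀ : ℕ) (hdeg : 2 * c₀ + 2 * dV = 2 * c + 2 * (dP + 1)) (t : T),
      complexGysin μ (hE t) hV (j t ≫ f) hdeg ∘ₗ (complexBetti.map (π t) (2 * c₀)).hom =
        complexGysin μ hZ hV f (show 2 * c + 2 * dV = 2 * c + 2 * dV from rfl) ∘ₗ
          (complexGysin μ (hE t) hZ (j t) hdeg ∘ₗ (complexBetti.map (π t) (2 * c₀)).hom) :=
    fun c₀ hdeg t ↦ by
    rw [complexGysin_comp (OrientationFamily.hasPoincareDuality μ) (hE t) hZ hV (j t) f hdeg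
      (show 2 * c + 2 * dV = 2 * c + 2 * dV from rfl)]
    exact LinearMap.comp_assoc _ _ _
  -- push the decomposition of `z'` on `Z` forward along `f_*`
  simp_rw [hcomp]
  simp_rw [LinearMap.range_comp _
    (complexGysin μ hZ hV f (show 2 * c + 2 * dV = 2 * c + 2 * dV from rfl)),
    ← Submodule.map_iSup, ← Submodule.map_sup]
  exact Submodule.mem_map_of_mem (hZspan z')

/-- **One clause of `hA`/`hB` from the blow-up diagram (1.25) `× W`, its two cohomological inputs,
and Fulton's Cor. 19.2 (b).** What a proof of the one-step statement (the hypotheses `hA`, `hB` of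
`FermatHodgeClassesLiftToCurvePowersSum_of_inductiveStep`) has to supply at `(V, M, P, c)` is
exactly: the varieties and morphisms of the diagram as smooth projective `ℂ`-schemes — `Z` (the
blow-up `× W`, of dimension `dim V`), `b`, `f`, the exceptional divisors `Eₜ` (dimension `dim P + 1`)
with FLAT `πₜ : Eₜ ⟶ P` and `jₜ : Eₜ ⟶ Z` (Thm. 1.7; Remark 1.9 for the first step; (2.18)) —, the
blow-up formula on `Z` (Lemma 2.1, spanning half: `hZspan`), the surjectivity of `f_* = (ψ × id)_*`
((2.3)–(2.9), (2.17): `hf`), and the contravariance of algebraic classes along the non-flat `b`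
(the named fact `fulton1998_map_mem_algebraicClasses`, Fulton Cor. 19.2 (b): `hF`). Then `Ψ = u • f_* b^*`
and `Θₜ = uₜ • (jₜ ≫ f)_* πₜ^*` do it (`inductiveStepClause_of_spans`).
[cite: ShiodaKatsura1979, §1 Thm. 1.7 (1.25), Remark 1.9; §2 Lemma 2.1, Prop. 2.4 (2.5), Cor. 2.5 (2.9), (2.17)–(2.19)]
[cite: VoisinHodgeI2002, Thm. 7.31 and §7.3.2] [cite: Fulton1998, Ch. 16 Def. 16.1.2 and §19.2 Cor. 19.2 (b)] -/
theorem inductiveStepClause_of_blowupDiagram (μ : OrientationFamily)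
    (hF : fulton1998_map_mem_algebraicClasses) {V M P Z : Motives.SchemeOver ℂ}
    {dV dP : ℕ} (hV : IsSmoothProjective dV V) (hM : IsSmoothProjective dV M)
    (hP : IsSmoothProjective dP P) (hdP : dP + 2 = dV) (c : ℕ)
    (hZ : IsSmoothProjective dV Z) (b : Z ⟶ M) (f : Z ⟶ V)
    {T : Type} [Fintype T] {E : T → Motives.SchemeOver ℂ}
    (hE : ∀ t, IsSmoothProjective (dP + 1) (E t)) (π : ∀ t, E t ⟶ P) [∀ t, Flat (π t).left]
    (j : ∀ t, E t ⟶ Z)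
    (hZspan : ∀ z : complexBetti Z (2 * c),
      z ∈ LinearMap.range (complexBetti.map b (2 * c)).hom ⊔
        ⨆ (c₀ : ℕ) (h : c₀ + 1 = c) (t : T), LinearMap.range
          (complexGysin μ (hE t) hZ (j t) (show 2 * c₀ + 2 * dV = 2 * c + 2 * (dP + 1) by omega) ∘ₗ
            (complexBetti.map (π t) (2 * c₀)).hom))
    (hf : Function.Surjective
      (complexGysin μ hZ hV f (show 2 * c + 2 * dV = 2 * c + 2 * dV from rfl))) :
    ∃ (Ψ : complexBetti M (2 * c) →ₗ[ℂ] complexBetti V (2 * c)) (T' : Type) (_ : Fintype T')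
      (Θ : ∀ c₀ : ℕ, c₀ + 1 = c → T' → (complexBetti P (2 * c₀) →ₗ[ℂ] complexBetti V (2 * c))),
      (∀ x ∈ algebraicClasses M c, Ψ x ∈ algebraicClasses V c) ∧
      (∀ x, IsRationalClass x → IsRationalClass (Ψ x)) ∧
      (∀ ⦃a b : ℕ⦄ ⦃x⦄, a + b = 2 * c → IsOfHodgeType dV M (2 * c) a b x →
          IsOfHodgeType dV V (2 * c) a b (Ψ x)) ∧
      (∀ c₀ (h : c₀ + 1 = c) (t : T'),
        (∀ y ∈ algebraicClasses P c₀, Θ c₀ h t y ∈ algebraicClasses V c) ∧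
        (∀ y, IsRationalClass y → IsRationalClass (Θ c₀ h t y)) ∧
        (∀ ⦃a b : ℕ⦄ ⦃y⦄, a + b = 2 * c₀ → IsOfHodgeType dP P (2 * c₀) a b y →
            IsOfHodgeType dV V (2 * c) (a + 1) (b + 1) (Θ c₀ h t y))) ∧
      ∀ z : complexBetti V (2 * c),
        z ∈ LinearMap.range Ψ ⊔ ⨆ (c₀ : ℕ) (h : c₀ + 1 = c) (t : T'), LinearMap.range (Θ c₀ h t) :=
  inductiveStepClause_of_spans μ hV hM hP hdP c hZ b f
    (fun _ hx ↦ complexGysin_map_mem_algebraicClasses_of_pullbackAlgebraic μ hF hZ hM hV b f rfl hx)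
    hE π (fun t ↦ j t ≫ f)
    (blowupDiagram_joint_surjective μ hV hdP c hZ b f hE π j hZspan hf)

/-! ### The surjectivity input discharged: `f` surjective suffices ((2.3)–(2.9) need only that
`ψ` is onto) -/

/-- **One clause of `hA`/`hB` from the blow-up diagram (1.25) `× W` with a SURJECTIVE `f`, the
blow-up formula on `Z`, and Fulton's Cor. 19.2 (b).** The same as
`inductiveStepClause_of_blowupDiagram`, with its cohomological input `hf` (`f_* = (ψ × id)_*` onto,
in print from `ψ_* ψ^* = m`, `ψ` of degree `m`, (2.3)–(2.4)) DISCHARGED from the geometric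
hypothesis that `f` is surjective: for a surjective morphism of smooth projective varieties `f^*`
is one-to-one (Voisin I Lemma 7.28) and so its Poincaré transpose `f_*` is onto
(`complexGysin_surjective_of_surjective`, file `ComplexGysinSurjective`). In the diagram `ψ × id`
is onto because `ψ : Z → X^{r+2}ₘ` is (Lemma 1.3 (ii): the restriction of `ψ` to `Z - (S₀ ∪ S_∞)`
is a finite morphism onto `X^{r+s}ₘ - (X^{r-1}ₘ ∪ X^{s-1}ₘ)`, and `ψ` is proper). What is left of
the clause is: the diagram as smooth projective `ℂ`-schemes with `f` surjective and the `πₜ` flat,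
the blow-up formula on `Z` (spanning half, `hZspan`), and `fulton1998_map_mem_algebraicClasses`
(`hF`). [cite: ShiodaKatsura1979, §1 Lemma 1.3 (ii), Thm. 1.7 (1.25); §2 Lemma 2.1, (2.3)–(2.9), (2.17)–(2.19)]
[cite: VoisinHodgeI2002, §7.3.2 Lemma 7.28 and Thm. 7.31] [cite: Fulton1998, §19.2 Cor. 19.2 (b)] -/
theorem inductiveStepClause_of_blowupDiagram_of_surjective (μ : OrientationFamily)
    (hF : fulton1998_map_mem_algebraicClasses) {V M P Z : Motives.SchemeOver ℂ}
    {dV dP : ℕ} (hV : IsSmoothProjective dV V) (hM : IsSmoothProjective dV M)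
    (hP : IsSmoothProjective dP P) (hdP : dP + 2 = dV) (c : ℕ)
    (hZ : IsSmoothProjective dV Z) (b : Z ⟶ M) (f : Z ⟶ V) [Surjective f.left]
    {T : Type} [Fintype T] {E : T → Motives.SchemeOver ℂ}
    (hE : ∀ t, IsSmoothProjective (dP + 1) (E t)) (π : ∀ t, E t ⟶ P) [∀ t, Flat (π t).left]
    (j : ∀ t, E t ⟶ Z)
    (hZspan : ∀ z : complexBetti Z (2 * c),
      z ∈ LinearMap.range (complexBetti.map b (2 * c)).hom ⊔
        ⨆ (c₀ : ℕ) (h : c₀ + 1 = c) (t : T), LinearMap.range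
          (complexGysin μ (hE t) hZ (j t) (show 2 * c₀ + 2 * dV = 2 * c + 2 * (dP + 1) by omega) ∘ₗ
            (complexBetti.map (π t) (2 * c₀)).hom)) :
    ∃ (Ψ : complexBetti M (2 * c) →ₗ[ℂ] complexBetti V (2 * c)) (T' : Type) (_ : Fintype T')
      (Θ : ∀ c₀ : ℕ, c₀ + 1 = c → T' → (complexBetti P (2 * c₀) →ₗ[ℂ] complexBetti V (2 * c))),
      (∀ x ∈ algebraicClasses M c, Ψ x ∈ algebraicClasses V c) ∧
      (∀ x, IsRationalClass x → IsRationalClass (Ψ x)) ∧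
      (∀ ⦃a b : ℕ⦄ ⦃x⦄, a + b = 2 * c → IsOfHodgeType dV M (2 * c) a b x →
          IsOfHodgeType dV V (2 * c) a b (Ψ x)) ∧
      (∀ c₀ (h : c₀ + 1 = c) (t : T'),
        (∀ y ∈ algebraicClasses P c₀, Θ c₀ h t y ∈ algebraicClasses V c) ∧
        (∀ y, IsRationalClass y → IsRationalClass (Θ c₀ h t y)) ∧
        (∀ ⦃a b : ℕ⦄ ⦃y⦄, a + b = 2 * c₀ → IsOfHodgeType dP P (2 * c₀) a b y →
            IsOfHodgeType dV V (2 * c) (a + 1) (b + 1) (Θ c₀ h t y))) ∧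
      ∀ z : complexBetti V (2 * c),
        z ∈ LinearMap.range Ψ ⊔ ⨆ (c₀ : ℕ) (h : c₀ + 1 = c) (t : T'), LinearMap.range (Θ c₀ h t) :=
  inductiveStepClause_of_blowupDiagram μ hF hV hM hP hdP c hZ b f hE π j hZspan
    (complexGysin_surjective_of_surjective μ hZ hV f rfl)

/-- The same clause with Fulton's Cor. 19.2 (b) replaced by the EQUIVALENT input "cup products of
algebraic classes are algebraic" (Voisin II Prop. 9.20, the tree's named fact
`Voisin2003_cupProduct_algebraicClasses`, towards which the tree's moving-lemma files work):
`fulton1998_map_mem_algebraicClasses_of_cupProduct` (file `AlgebraicClassesPullbackOfCupProduct`).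
[cite: ShiodaKatsura1979, §1 Thm. 1.7 (1.25); §2 Lemma 2.1, (2.3)–(2.9), (2.17)–(2.19)]
[cite: VoisinHodgeII2003, §9.2.4 Prop. 9.20 and Prop. 9.21 (i)] [cite: Fulton1998, §19.2 Cor. 19.2 (b)] -/
theorem inductiveStepClause_of_blowupDiagram_of_cupProduct (μ : OrientationFamily)
    (hcup : Voisin2003_cupProduct_algebraicClasses) {V M P Z : Motives.SchemeOver ℂ}
    {dV dP : ℕ} (hV : IsSmoothProjective dV V) (hM : IsSmoothProjective dV M)
    (hP : IsSmoothProjective dP P) (hdP : dP + 2 = dV) (c : ℕ)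
    (hZ : IsSmoothProjective dV Z) (b : Z ⟶ M) (f : Z ⟶ V) [Surjective f.left]
    {T : Type} [Fintype T] {E : T → Motives.SchemeOver ℂ}
    (hE : ∀ t, IsSmoothProjective (dP + 1) (E t)) (π : ∀ t, E t ⟶ P) [∀ t, Flat (π t).left]
    (j : ∀ t, E t ⟶ Z)
    (hZspan : ∀ z : complexBetti Z (2 * c),
      z ∈ LinearMap.range (complexBetti.map b (2 * c)).hom ⊔
        ⨆ (c₀ : ℕ) (h : c₀ + 1 = c) (t : T), LinearMap.range
          (complexGysin μ (hE t) hZ (j t) (show 2 * c₀ + 2 * dV = 2 * c + 2 * (dP + 1) by omega) ∘ₗ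
            (complexBetti.map (π t) (2 * c₀)).hom)) :
    ∃ (Ψ : complexBetti M (2 * c) →ₗ[ℂ] complexBetti V (2 * c)) (T' : Type) (_ : Fintype T')
      (Θ : ∀ c₀ : ℕ, c₀ + 1 = c → T' → (complexBetti P (2 * c₀) →ₗ[ℂ] complexBetti V (2 * c))),
      (∀ x ∈ algebraicClasses M c, Ψ x ∈ algebraicClasses V c) ∧
      (∀ x, IsRationalClass x → IsRationalClass (Ψ x)) ∧
      (∀ ⦃a b : ℕ⦄ ⦃x⦄, a + b = 2 * c → IsOfHodgeType dV M (2 * c) a b x →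
          IsOfHodgeType dV V (2 * c) a b (Ψ x)) ∧
      (∀ c₀ (h : c₀ + 1 = c) (t : T'),
        (∀ y ∈ algebraicClasses P c₀, Θ c₀ h t y ∈ algebraicClasses V c) ∧
        (∀ y, IsRationalClass y → IsRationalClass (Θ c₀ h t y)) ∧
        (∀ ⦃a b : ℕ⦄ ⦃y⦄, a + b = 2 * c₀ → IsOfHodgeType dP P (2 * c₀) a b y →
            IsOfHodgeType dV V (2 * c) (a + 1) (b + 1) (Θ c₀ h t y))) ∧
      ∀ z : complexBetti V (2 * c),
        z ∈ LinearMap.range Ψ ⊔ ⨆ (c₀ : ℕ) (h : c₀ + 1 = c) (t : T'), LinearMap.range (Θ c₀ h t) :=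
  inductiveStepClause_of_blowupDiagram_of_surjective μ
    (fulton1998_map_mem_algebraicClasses_of_cupProduct hcup) hV hM hP hdP c hZ b f hE π j hZspan

/-! ### The named fact from Fulton's Cor. 19.2 (b) and the GEOMETRY of Thm. 1.7 with the blow-up formula -/

/-- **`FermatHodgeClassesLiftToCurvePowersSum` from `fulton1998_map_mem_algebraicClasses` and the
blow-up diagrams of Shioda–Katsura's Thm. 1.7 with their blow-up formula.** The residual input of
the whole formalisation, in purely geometric-plus-Lemma-2.1 form. Hypothesis `hA'` (the first step,
Remark 1.9 `× W`: `X²ₘ` from `X¹ₘ × X¹ₘ`, centre `X⁰ₘ × X⁰ₘ × W` = `m²` copies of `W`) and `hB'`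
(Thm. 1.7 at `(r + 1, 1)` `× W`, `r ≥ 1`: `X^{r+2}ₘ` from `X^{r+1}ₘ × X¹ₘ`, centre components
`Xʳₘ × W`) ask, for every `m ≥ 1`, every smooth projective auxiliary factor `W` and every
half-degree `c`, for: a smooth projective `Z` of the dimension of the target (in print the blow-up
(1.4) `× W`, Lemma 1.2) with a morphism `b` to the main host (`β × id`) and a SURJECTIVE morphism
`f` to the target (`ψ × id`; `ψ` is onto by Lemma 1.3 (ii) and properness), finitely many smooth
projective `Eₜ` of dimension `dim P + 1` with FLAT `πₜ : Eₜ ⟶ P` and `jₜ : Eₜ ⟶ Z` (the exceptional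
`ℙ¹`-bundles over the components of the centre, (1.6)), and the blow-up formula on `Z` in degree
`2c`, spanning half (Lemma 2.1 for a centre of codimension `2`:
`H²ᶜ(Z) = b^* H²ᶜ(M) + Σₜ jₜ,* πₜ^* H^{2c-2}(P)`), for some orientation family `μ`. Granted these
and Fulton's Cor. 19.2 (b) (`hF`, pull-back of algebraic classes along the non-flat `b`; equivalently
Voisin II Prop. 9.20, `fulton1998_map_mem_algebraicClasses_iff_cupProduct`), each clause of the
one-step statement holds (`inductiveStepClause_of_blowupDiagram_of_surjective`: `Ψ = u • f_* b^*`,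
`Θₜ = uₜ • (jₜ ≫ f)_* πₜ^*`, with `f_*` onto by `complexGysin_surjective_of_surjective`), and the
induction on `r` (`FermatHodgeClassesLiftToCurvePowersSum_of_inductiveStep`) gives the named fact.
[cite: ShiodaKatsura1979, §1 (1.4)–(1.6), Lemma 1.2, Lemma 1.3 (ii), Thm. 1.7 (1.25), Remark 1.9; §2 Lemma 2.1, Prop. 2.4 (2.5), Cor. 2.5 (2.9), (2.17)–(2.19); §3 p. 107–108]
[cite: Fulton1998, §19.2 Cor. 19.2 (b)] [cite: VoisinHodgeI2002, Thm. 7.31 and §7.3.2 Lemma 7.28] [cite: Voisin2025, Cor. 2.12] -/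
theorem FermatHodgeClassesLiftToCurvePowersSum_of_blowupDiagrams
    (hF : fulton1998_map_mem_algebraicClasses)
    (hA' : ∀ (m : ℕ), 1 ≤ m → ∀ (w : ℕ) (W : Motives.SchemeOver ℂ), IsSmoothProjective w W →
      ∀ (c : ℕ),
      ∃ (μ : OrientationFamily) (Z : Motives.SchemeOver ℂ) (hZ : IsSmoothProjective (2 + w) Z)
        (b : Z ⟶ (fermatHypersurface 1 m ⊗ fermatHypersurface 1 m) ⊗ W)
        (f : Z ⟶ fermatHypersurface 2 m ⊗ W) (_ : Surjective f.left)
        (T : Type) (_ : Fintype T) (E : T → Motives.SchemeOver ℂ)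
        (hE : ∀ t, IsSmoothProjective (w + 1) (E t)) (π : ∀ t, E t ⟶ W)
        (_ : ∀ t, Flat (π t).left) (j : ∀ t, E t ⟶ Z),
        ∀ z : complexBetti Z (2 * c),
          z ∈ LinearMap.range (complexBetti.map b (2 * c)).hom ⊔
            ⨆ (c₀ : ℕ) (h : c₀ + 1 = c) (t : T), LinearMap.range
              (complexGysin μ (hE t) hZ (j t)
                  (show 2 * c₀ + 2 * (2 + w) = 2 * c + 2 * (w + 1) by omega) ∘ₗ
                (complexBetti.map (π t) (2 * c₀)).hom))
    (hB' : ∀ (m r : ℕ), 1 ≤ m → 1 ≤ r → ∀ (w : ℕ) (W : Motives.SchemeOver ℂ),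
      IsSmoothProjective w W → ∀ (c : ℕ),
      ∃ (μ : OrientationFamily) (Z : Motives.SchemeOver ℂ) (hZ : IsSmoothProjective (r + 2 + w) Z)
        (b : Z ⟶ (fermatHypersurface (r + 1) m ⊗ fermatHypersurface 1 m) ⊗ W)
        (f : Z ⟶ fermatHypersurface (r + 2) m ⊗ W) (_ : Surjective f.left)
        (T : Type) (_ : Fintype T) (E : T → Motives.SchemeOver ℂ)
        (hE : ∀ t, IsSmoothProjective (r + w + 1) (E t)) (π : ∀ t, E t ⟶ fermatHypersurface r m ⊗ W)
        (_ : ∀ t, Flat (π t).left) (j : ∀ t, E t ⟶ Z),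
        ∀ z : complexBetti Z (2 * c),
          z ∈ LinearMap.range (complexBetti.map b (2 * c)).hom ⊔
            ⨆ (c₀ : ℕ) (h : c₀ + 1 = c) (t : T), LinearMap.range
              (complexGysin μ (hE t) hZ (j t)
                  (show 2 * c₀ + 2 * (r + 2 + w) = 2 * c + 2 * (r + w + 1) by omega) ∘ₗ
                (complexBetti.map (π t) (2 * c₀)).hom)) :
    FermatHodgeClassesLiftToCurvePowersSum := by
  refine FermatHodgeClassesLiftToCurvePowersSum_of_inductiveStep (fun m hm w W hW c ↦ ?_)
    (fun m r hm hr w W hW c ↦ ?_)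
  · obtain ⟨μ, Z, hZ, b, f, hf, T, hT, E, hE, π, hπ, j, hZspan⟩ := hA' m hm w W hW c
    haveI := hf
    haveI := hT
    haveI := hπ
    have h1 : IsSmoothProjective 1 (fermatHypersurface 1 m) :=
      isSmoothProjective_fermatHypersurface le_rfl hm
    have h2 : IsSmoothProjective 2 (fermatHypersurface 2 m) :=
      isSmoothProjective_fermatHypersurface (by norm_num) hm
    have hV : IsSmoothProjective (2 + w) (fermatHypersurface 2 m ⊗ W) :=
      IsSmoothProjective.tensor_holds h2 hW
    have hM : IsSmoothProjective (2 + w) ((fermatHypersurface 1 m ⊗ fermatHypersurface 1 m) ⊗ W) :=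
      IsSmoothProjective.tensor_holds (IsSmoothProjective.tensor_holds h1 h1) hW
    exact inductiveStepClause_of_blowupDiagram_of_surjective μ hF hV hM hW (by omega) c hZ b f hE
      π j hZspan
  · obtain ⟨μ, Z, hZ, b, f, hf, T, hT, E, hE, π, hπ, j, hZspan⟩ := hB' m r hm hr w W hW c
    haveI := hf
    haveI := hT
    haveI := hπ
    have h1 : IsSmoothProjective 1 (fermatHypersurface 1 m) :=
      isSmoothProjective_fermatHypersurface le_rfl hm
    have hr0 : IsSmoothProjective r (fermatHypersurface r m) :=
      isSmoothProjective_fermatHypersurface hr hm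
    have hr1 : IsSmoothProjective (r + 1) (fermatHypersurface (r + 1) m) :=
      isSmoothProjective_fermatHypersurface (by omega) hm
    have hr2 : IsSmoothProjective (r + 2) (fermatHypersurface (r + 2) m) :=
      isSmoothProjective_fermatHypersurface (by omega) hm
    have hV : IsSmoothProjective (r + 2 + w) (fermatHypersurface (r + 2) m ⊗ W) :=
      IsSmoothProjective.tensor_holds hr2 hW
    have hM₁ : IsSmoothProjective (r + 1 + 1)
        (fermatHypersurface (r + 1) m ⊗ fermatHypersurface 1 m) :=
      IsSmoothProjective.tensor_holds hr1 h1
    have hM : IsSmoothProjective (r + 2 + w)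
        ((fermatHypersurface (r + 1) m ⊗ fermatHypersurface 1 m) ⊗ W) :=
      IsSmoothProjective.tensor_holds (n := r + 2) hM₁ hW
    have hP : IsSmoothProjective (r + w) (fermatHypersurface r m ⊗ W) :=
      IsSmoothProjective.tensor_holds hr0 hW
    exact inductiveStepClause_of_blowupDiagram_of_surjective μ hF hV hM hP (by omega) c hZ b f hE
      π j hZspan

end BlowupDiagram

/-! ### The Fermat surfaces unconditionally: what is left is `X²ᵖₘ`, `p ≥ 2` -/

section Surfaces

/-- **`FermatHodgeClassesLiftToCurvePowersSum` reduced to the middle cohomology of `X²ᵖₘ`, `p ≥ 2`,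
UNCONDITIONALLY.** For the Fermat surfaces `X²ₘ` (all `m ≥ 1`) every rational `(1,1)`-class is
algebraic by Lefschetz's theorem on `(1,1)`-classes, now a theorem of the tree
(`lefschetzOneOne_rational_holds`, Voisin I Thm. 11.30 via Kodaira–Serre), so point hosts suffice
there (`FermatHodgeClassesLiftToCurvePowersSum_of_lefschetzOneOne_of_middle` with its hypothesis `hL`
discharged); all degrees `2p ≠ n` are `fermatHodgeClassesLiftSum_of_two_mul_ne`. What is left of
the named fact is exactly a dominating family for the rational `(p,p)`-classes of `H²ᵖ(X²ᵖₘ(ℂ); ℂ)`,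
`p ≥ 2` (Shioda–Katsura's inductive structure, `exists_family_fermat` under `hA`, `hB`).
[cite: VoisinHodgeI2002, Thm. 11.30 and §11.3.3] [cite: ShiodaKatsura1979, §2 Thm. 2.6, Remark 2.11; §3 p. 107–108] -/
theorem FermatHodgeClassesLiftToCurvePowersSum_of_middle_two_le
    (hmid : ∀ (m p : ℕ), 1 ≤ m → 2 ≤ p →
      ∃ (ι : Type) (_ : Fintype ι) (k q : ι → ℕ)
        (F : ∀ i, complexBetti ((fermatHypersurface 1 m).pow (k i)) (2 * q i) →ₗ[ℂ]
          complexBetti (fermatHypersurface (2 * p) m) (2 * p)),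
        (∀ i, ∀ a ∈ algebraicClasses ((fermatHypersurface 1 m).pow (k i)) (q i),
            F i a ∈ algebraicClasses (fermatHypersurface (2 * p) m) p) ∧
        ∀ c : complexBetti (fermatHypersurface (2 * p) m) (2 * p), IsRationalClass c →
          IsOfHodgeType (2 * p) (fermatHypersurface (2 * p) m) (2 * p) p p c →
            ∃ a : ∀ i, complexBetti ((fermatHypersurface 1 m).pow (k i)) (2 * q i),
              (∀ i, IsRationalClass (a i) ∧
                IsOfHodgeType (k i) ((fermatHypersurface 1 m).pow (k i)) (2 * q i) (q i) (q i)
                  (a i)) ∧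
              c = ∑ i, F i (a i)) :
    FermatHodgeClassesLiftToCurvePowersSum :=
  FermatHodgeClassesLiftToCurvePowersSum_of_lefschetzOneOne_of_middle lefschetzOneOne_rational_holds
    hmid

/-- **The Hodge classes of the Fermat surfaces lift (trivially) for every degree `m`**: the body of
the named fact at `(m, 2, 1)`, `m ≥ 1`, with point hosts, unconditionally — every rational
`(1,1)`-class of `X²ₘ` is algebraic (`lefschetzOneOne_rational_holds`), so
`exists_pointHosts_of_forall_mem_algebraicClasses` applies. (The Hodge conjecture for `X²ₘ` itself:
the `3m²` lines for `m ≤ 3`, and in general Lefschetz `(1,1)`; Shioda–Katsura Thm. 2.6, Remark 2.11.)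
[cite: VoisinHodgeI2002, Thm. 11.30] [cite: ShiodaKatsura1979, §2 Thm. 2.6 and Remark 2.11] -/
theorem fermatHodgeClassesLiftSum_surface {m : ℕ} (hm : 1 ≤ m) :
    ∃ (ι : Type) (_ : Fintype ι) (k q : ι → ℕ)
      (F : ∀ i, complexBetti ((fermatHypersurface 1 m).pow (k i)) (2 * q i) →ₗ[ℂ]
        complexBetti (fermatHypersurface 2 m) (2 * 1)),
      (∀ i, ∀ a ∈ algebraicClasses ((fermatHypersurface 1 m).pow (k i)) (q i),
          F i a ∈ algebraicClasses (fermatHypersurface 2 m) 1) ∧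
      ∀ c : complexBetti (fermatHypersurface 2 m) (2 * 1), IsRationalClass c →
        IsOfHodgeType 2 (fermatHypersurface 2 m) (2 * 1) 1 1 c →
          ∃ a : ∀ i, complexBetti ((fermatHypersurface 1 m).pow (k i)) (2 * q i),
            (∀ i, IsRationalClass (a i) ∧
              IsOfHodgeType (k i) ((fermatHypersurface 1 m).pow (k i)) (2 * q i) (q i) (q i)
                (a i)) ∧
            c = ∑ i, F i (a i) :=
  exists_pointHosts_of_forall_mem_algebraicClasses
    (isSmoothProjective_fermatHypersurface (by norm_num) hm) _ 1
    fun c hc hcH ↦ lefschetzOneOne_rational_holds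
      (isSmoothProjective_fermatHypersurface (by norm_num) hm) c hc hcH

end Surfaces

end Literature.AlgebraicGeometry.HodgeTheory

end
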